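import Literature.NumberTheory.Automorphic.SelfdualGL3AdjointLift
import Literature.NumberTheory.Automorphic.GelbartJacquetSymmSquare
import Literature.NumberTheory.Automorphic.KimExteriorSquareGL4Proofs
import Literature.NumberTheory.Automorphic.AutomorphicTwistHecke
import Literature.NumberTheory.Automorphic.AutomorphicRepsGLSatakeFlathProofs
import Literature.NumberTheory.Automorphic.CuspidalDescentDetCubicRepData
import Literature.NumberTheory.Automorphic.AdelicGroupDataAutomorphicMeasureProofs
import Literature.NumberTheory.Automorphic.PairLFunctionPolesRepData
import Literature.NumberTheory.Automorphic.PairLFunctionPolesRepDataHolds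
import Literature.NumberTheory.Automorphic.RamakrishnanMultiplicityOneLemma414
import Literature.NumberTheory.GaloisRepresentations.HeckeCharacterWeakApproximation
import Literature.NumberTheory.GaloisRepresentations.HeckeCharacterCofiniteProofs
import HarnessLib

/-!
# Ramakrishnan (2014), Theorem A: the printed proof mapped onto the tree (proved reductions)

Topic `NumberTheory/Automorphic`; namespace `Literature.NumberTheory.Automorphic`. Sibling proof
file of `SelfdualGL3AdjointLift`, working towards the discharge
`Ramakrishnan2014_selfdualGL3_adjointLift_holds` of the named fact
`Ramakrishnan2014_selfdualGL3_adjointLift` (D. Ramakrishnan, *An exercise concerning the selfdual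
cusp forms on `GL(3)`*, Indian J. Pure Appl. Math. 45 (2014), 777–785, Theorem A and the remark
following it). Theorems only; no definition, no named fact, no `sorry`.

## The printed proof and what is proved here

Let `Π` be cuspidal on `GL(3)/F` with `Π^∨ ≃ Π ⊗ η` (Theorem A: `η = 1`; the remark on p. 777:
`η = |·|^t`; Shavali 2026, Lemma 4.7: any `η`), `ω = ω_Π`. The printed argument runs:

1. *Central character.* `ω⁻¹ = ω η³`, i.e. `η³ ω² = 1` (`ω² = 1` in the selfdual case, so that
   `ν := ω` is quadratic). **Proved here** on the unramified shadow (`ω(ϖ_v) = ∏ t_{Π,v}`,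
   `t_{Π^∨,v} = t_{Π,v}⁻¹`, `t_{Π ⊗ η,v} = η(ϖ_v) t_{Π,v}`):
   `pow_card_mul_prod_sq_eq_one_of_map_inv_eq_map_mul` (`{a⁻¹} = {e a} ⟹ e^{card} (∏ a)² = 1`),
   `prod_sq_eq_one_of_map_inv_eq_self`.
2. *Factorisation of the Rankin–Selberg square.* `L^S(s, Π × Π) = L^S(s, Π, sym²) L^S(s, Π, Λ²)`
   and, `Π` being `3`-dimensional, `Λ²Π ≃ Π^∨ ⊗ ω ≃ Π ⊗ ηω`; hence
   `L^S(s, Π × Π^∨ ⊗ η⁻¹) = L^S(s, Π, sym²) L^S(s, Π ⊗ ηω)`. **Proved here** on Satake parameters, in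
   the tree's carriers `satakeTensor` (`PairLFunctionBaseChange`), `symmSqParams`
   (`GelbartJacquetSymmSquare`) and `wedgeTwoParams` (`KimExteriorSquareGL4`):
   `satakeTensor_self_eq_symmSqParams_add_wedgeTwoParams` (`t ⊗ t = Sym² t + Λ² t`, any rank),
   `wedgeTwoParams_eq_map_inv_of_card_eq_three` (`Λ² t = (∏ t) · t⁻¹` in rank `3`),
   `wedgeTwoParams_eq_map_of_map_inv_eq_map_mul` and
   `satakeTensor_self_eq_of_map_inv_eq_map_mul` (the essentially selfdual case:
   `t ⊗ t = Sym² t + (e ∏ t) · t`), and the almost-everywhere form for a cuspidal Borel–Jacquet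
   datum `P` on `GL₃(𝔸_F)` under the hypothesis of the named fact,
   `Ramakrishnan2014_selfdualGL3_adjointLift.eventually_shadow` / `ae_shadow` (the latter
   unconditional thanks to `AutomorphicRepData.HasSatakeParamAt.zero_not_mem`: the entries of a
   Satake parameter of a Borel–Jacquet datum are non-zero, the central Hecke operator `T_{v,n}`
   being right translation by `ϖ_v · 1_n`, proved here for the `AutomorphicRepData` model).
3. *The pole.* By Jacquet–Shalika `L^S(s, Π × Π^∨)` has a simple pole at `s = 1` while
   `L^S(s, Π ⊗ ω)` is holomorphic and non-zero there, so `L^S(s, Π, sym²)` has a pole at `s = 1`.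
   **Proved here** for Borel–Jacquet data, granting Jacquet–Shalika (2.1)–(2.3) for such data
   (the named facts `JacquetShalika1981_{multipliable_partialPairL,partialPairL_boundary,partialPairL_pole}_repData`
   of `PairLFunctionPolesRepData`) and the central character `ω_Π` at Satake level:
   `symmSq_pole_core`, `Ramakrishnan2014_selfdualGL3_adjointLift.symmSq_pole_of_selfdual`
   (`(s - 1) L^S(s, Π, sym²) → c ≠ 0` as `s → 1⁺`, with `L^S(s, Π, sym²) = partialStandardL S (Sym² t_Π)`
   a convergent Euler product near `s = 1`) and `…_of_leaves` (`ω_Π` from the Borel–Jacquet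
   dictionary leaves); `ω_Π` enters as a cuspidal datum on `GL₁`
   (the private `exists_cuspidal_glOne_of_heckeCharacter`).
4. *Descent.* By Ginzburg–Rallis–Soudry the pole forces `Π ⊗ ω` to be the functorial lift
   (`SO₃(ℂ) ↪ GL₃(ℂ)`) of a generic cuspidal `σ` on `Sp₂(𝔸_F) = SL₂(𝔸_F)`.
5. *Back to `GL(2)`.* `σ` occurs in the restriction of a cuspidal `π` on `GL₂(𝔸_F)`
   (Labesse–Langlands), the lift of `σ` is the Gelbart–Jacquet lift `Ad(π)`, so
   `Π ≃ Ad(π) ⊗ ν`, `ν = ω`; `π` is not dihedral because `Π` is cuspidal; uniqueness of `π` up to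
   twist is multiplicity one for `SL(2)`. The clause "`π` is not dihedral because `Π` is cuspidal"
   is **proved here** for Borel–Jacquet data, granting Jacquet–Shalika (2.1)–(2.3) for such data and
   the central character of `π` at Satake level: `adjoint_dihedral_core`,
   `Ramakrishnan2014_selfdualGL3_adjointLift.not_isQuadraticSelfTwistAE_of_JS` (if `π ≅ π ⊗ ε_{K/F}`
   a.e. then `L^S(s, π × π^∨) = L^S(s, (Π ⊗ ν⁻¹) × ε_{K/F}) L^S(s, ε_{K/F})` would have no pole at
   `s = 1`); hence `…of_selfdualLift_of_JS_of_leaves` — the named fact from the bare descent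
   statement "every cuspidal `Π` on `GL₃` with selfdual Satake parameters is `Ad(π) ⊗ ν` a.e. for
   some cuspidal `π` on `GL₂` and `ν² = 1`" plus (2.1)–(2.3) and the dictionary leaves.
6. *General `η`.* `μ := (ωη)⁻¹` has `μ² = η` by step 1, `Π ⊗ μ` is selfdual, and steps 1–5 apply.
   **Proved here** for Borel–Jacquet data:
   `Ramakrishnan2014_selfdualGL3_adjointLift.of_selfdual_of_centralCharacter` — the named fact
   follows from Theorem A as printed (the selfdual case, hypothesis `hA`) once every cuspidal `Π`
   on `GL₃(𝔸_F)` has a Hecke character `Ω` with `Ω(ϖ_v) = ∏ t_{Π,v}` a.e. (its central character,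
   hypothesis `hΩ`) — by the twist `Π ⊗ (μ ∘ det)` by an arbitrary idèle class character
   (`CuspidalAutomorphicRepData.exists_twist_hecke_hasSatakeParamAt`, `AutomorphicTwistHecke`), the
   rigidity of Hecke characters (`HeckeCharacter.ext_of_eventually_valueAtUniformizer_eq`: `μ² = η`
   exactly) and Flath's uniqueness / almost-everywhere existence of Satake parameters
   (`hasSatakeParamAt_unique_holds`, `hasSatakeParamAt_cofinite_holds`); and
   `…of_selfdual_of_leaves` — `hΩ` discharged from the three named leaves of the Borel–Jacquet
   dictionary at rank `3` (`exists_isAssociatedL2`, `hasSatakeParamAt_iff_L2`,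
   `stable_cuspidal_eq_sSup_irreducible`, via `exists_heckeCharacter_prod_satake_of_sSup_irreducible`
   and Borel–Harish-Chandra finiteness `exists_isAutomorphicMeasure_gl_holds`).
7. *The converse* (Shavali 2026, Lemma 4.7 is an equivalence; "`Ad(π) ⊗ ν` is selfdual for
   `ν² = 1`"). **Proved here**, unconditionally: `Ramakrishnan2014_selfdualGL3_adjointLift.converse`
   (`t_{Π,v} = ν(ϖ_v) Ad(t_{π,v})` a.e. forces `t_{Π,v}⁻¹ = ν⁻²(ϖ_v) t_{Π,v}` a.e.; `Ad(t)⁻¹ = Ad(t)`,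
   `adParams_map_inv`), `converse_selfdual`, and "`ν` is simply the central character of `Π`":
   `valueAtUniformizer_pow_three_eq_prod` (`ν(ϖ_v)³ = ∏ t_{Π,v}`), `valueAtUniformizer_eq_prod`
   (`ν(ϖ_v) = ∏ t_{Π,v} = ω_Π(ϖ_v)` when `ν² = 1`).
8. *Uniqueness.* "The form `π` is unique up to a character twist" (Theorem A; "uniqueness of `π`
   up to twist is multiplicity one for `SL(2)`"). **Proved here** granted multiplicity one for
   `SL(2)` in the tree's form (`Ramakrishnan2000_multiplicityOneSL2`, Ramakrishnan 2000, Thm. 4.1.2):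
   `Ramakrishnan2014_selfdualGL3_adjointLift.unique_up_to_twist` — two pairs `(π, ν)`, `(π', ν')`
   with `t_Π = ν Ad(t_π) = ν' Ad(t_{π'})` a.e. have `π'` an a.e. twist of `π` (`IsSatakeTwistBy`),
   through the rigidity `c Ad(t) = Ad(t') ⟹ Ad(t) = Ad(t')` (`adParams_eq_of_eq_map_mul`).
9. *Update (the Borel–Jacquet dictionary and (2.1) discharged).* The central character of a
   cuspidal Borel–Jacquet datum at Satake level is meanwhile a theorem of the tree
   (`exists_heckeCharacter_prod_satake'`, `CuspidalDescentDetCubicRepData`, from the discharged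
   leaves `AutomorphicRepsGL.exists_le_formsOfL2_of_W'_eq_bot_holds` and
   `AutomorphicRepsGL.stable_cuspidal_eq_sSup_irreducible_holds`), and so is (2.1) for such data
   (`JacquetShalika1981_multipliable_partialPairL_repData_holds`, `PairLFunctionPolesRepDataHolds`).
   Section `Holds` feeds them in: `Ramakrishnan2014_selfdualGL3_adjointLift.of_selfdual` (the named
   fact from Theorem A for selfdual `Π` **and nothing else** — step 6 unconditionally),
   `…symmSq_pole` and `…not_isQuadraticSelfTwistAE` (steps 3 and 5-clause from (2.2), (2.3) alone),
   `…of_selfdualLift_of_JS` (the named fact from the bare descent statement and (2.2), (2.3)), and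
   conversely `…selfdualLift` (the named fact *contains* the bare descent statement, `η = 1`), whence
   `…iff_selfdualLift_of_JS`: granting (2.2), (2.3) for Borel–Jacquet data the named fact is
   **equivalent** to the descent statement of steps 4–5.

## What remains for `Ramakrishnan2014_selfdualGL3_adjointLift_holds` (not in this file)

By `of_selfdual`: exactly Theorem A for **selfdual** `Π` (steps 3–5); of these, step 3 (the pole of
`L^S(s, Π, sym²)`) is proved here granted Jacquet–Shalika (2.2), (2.3) for Borel–Jacquet data (named
facts of `PairLFunctionPolesRepData`, reduced to their `L²` forms in `PairLFunctionPolesRepDataHolds`),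
and so is the clause "`π` is not dihedral" of step 5. Step 4 (the descent `GL(3) → SL(2)` from the
pole, Ginzburg–Rallis–Soudry) and the Labesse–Langlands extension `SL(2) → GL(2)` of step 5 have
**no carrier in the tree**: there is no automorphy datum for `SL₂`, `Sp_{2n}` or `SO_m` and no theta
correspondence / descent statement (`lean search`); the Gelbart–Jacquet lift of step 5 is the
unproved named fact `GelbartJacquet_adjoint_lift` (`LanglandsTetrahedral`; not needed at Satake
level). Precisely: `Ramakrishnan2014_selfdualGL3_adjointLift_holds` is
`of_selfdualLift_of_JS hA' hJ2 hJ3` for a proof `hA'` of the bare descent statement "every cuspidal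
`Π` on `GL₃(𝔸_F)` with selfdual Satake parameters a.e. is `Ad(π) ⊗ ν` a.e. for a cuspidal `π` on
`GL₂(𝔸_F)` and `ν² = 1`" and the Jacquet–Shalika facts (2.2), (2.3) for Borel–Jacquet data — and by
`iff_selfdualLift_of_JS` nothing less than `hA'` will do. (Step 6, which needs the central character
of a cuspidal Borel–Jacquet datum as a Hecke character and twists by Hecke characters of infinite
order, is proved here from `AutomorphicTwistHecke` and `exists_heckeCharacter_prod_satake'`, see 6.
and 9. above.)

## References

* D. Ramakrishnan, *An exercise concerning the selfdual cusp forms on GL(3)*, Indian J. Pure Appl.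
  Math. 45 (2014), no. 5, 777–785, Theorem A and the remark following it (p. 777).
  [Ramakrishnan2014]
* A. Shavali, *On the image of automorphic Galois representations*, IMRN 2026 (arXiv:2502.10799),
  Lemma 4.7 (proof). [Shavali2026]
* D. Ginzburg, S. Rallis, D. Soudry, *On explicit lifts of cusp forms from `GL_m` to classical
  groups*, Ann. of Math. 150 (1999), 807–866.
* H. Jacquet, J. Shalika, *On Euler products and the classification of automorphic forms I, II*,
  Amer. J. Math. 103 (1981). [JacquetShalika1981]
* H. H. Kim, *Functoriality for the exterior square of `GL₄` and the symmetric fourth of `GL₂`*,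
  J. Amer. Math. Soc. 16 (2003), Introduction (`∧²` of a Satake parameter). [Kim2002]
* A. Borel, H. Jacquet, *Automorphic forms and automorphic representations*, Proc. Sympos. Pure
  Math. 33 (Corvallis 1979), part 1, §4.6 and 5.7. [BorelJacquetCorvallis1979]
* J. Arthur, L. Clozel, *Simple algebras, base change, and the advanced theory of the trace
  formula*, Ann. of Math. Stud. 120 (1989), Ch. 3 §2, (2.1)–(2.3), p. 171. [ArthurClozelAMS120]
* J. W. S. Cassels, A. Fröhlich (eds.), *Algebraic Number Theory* (1967), Ch. VII §4, Prop. 4.1.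
  [CasselsFrohlichANT1967]
* D. Ramakrishnan, *Modularity of the Rankin–Selberg `L`-series, and multiplicity one for `SL(2)`*,
  Ann. of Math. (2) 152 (2000), 45–111, Thm. 4.1.2. [Ramakrishnan2000]
-/

noncomputable section

open scoped MatrixGroups NumberField Classical Topology
open NumberField IsDedekindDomain Filter Polynomial

namespace Literature.NumberTheory.Automorphic

open Literature.NumberTheory.GaloisRepresentations (HeckeCharacter ideleGroup localUnits)

/-! ### Step 1: the central character of an essentially selfdual form (unramified shadow) -/

section CentralCharacter

/-- **`η³ ω² = 1` on Satake parameters.** If the multiset `α` (no zero entry) satisfies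
`{a⁻¹ : a ∈ α} = {e a : a ∈ α}` — the unramified shadow at `v` of `Π^∨ ≃ Π ⊗ η` with
`e = η(ϖ_v)`, `α = t_{Π,v}` — then `e ^ (card α) · (∏ α)² = 1`, the shadow of `η^n ω_Π² = 1`
(`ω_Π(ϖ_v) = ∏ t_{Π,v}`; Shavali 2026, proof of Lemma 4.7: "comparing central characters,
`χ³ = ω²`" for `GL(3)`). Take products of both sides. [cite: Shavali2026, Lemma 4.7 (proof)] -/
theorem pow_card_mul_prod_sq_eq_one_of_map_inv_eq_map_mul {α : Multiset ℂ} {e : ℂ}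
    (h0 : (0 : ℂ) ∉ α) (h : α.map (fun a => a⁻¹) = α.map (fun a => e * a)) :
    e ^ Multiset.card α * α.prod ^ 2 = 1 := by
  have hp : α.prod ≠ 0 := Multiset.prod_ne_zero h0
  have h1 := congrArg Multiset.prod h
  rw [Multiset.prod_map_inv', Multiset.prod_map_mul, Multiset.map_const', Multiset.prod_replicate,
    Multiset.map_id'] at h1
  calc e ^ Multiset.card α * α.prod ^ 2 = (e ^ Multiset.card α * α.prod) * α.prod := by ring
    _ = α.prod⁻¹ * α.prod := by rw [← h1]
    _ = 1 := inv_mul_cancel₀ hp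

/-- **`ω² = 1` for a selfdual form, on Satake parameters** (Ramakrishnan 2014, Theorem A: "`ν`
… with `ν² = 1` … is simply the central character of `Π`"): if `{a⁻¹ : a ∈ α} = α` (the shadow
of `Π^∨ ≃ Π`) and `α` has no zero entry then `(∏ α)² = 1`. [cite: Ramakrishnan2014, Theorem A] -/
theorem prod_sq_eq_one_of_map_inv_eq_self {α : Multiset ℂ} (h0 : (0 : ℂ) ∉ α)
    (h : α.map (fun a => a⁻¹) = α) : α.prod ^ 2 = 1 := by
  have h' : α.map (fun a => a⁻¹) = α.map (fun a => 1 * a) := by simpa using h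
  simpa using pow_card_mul_prod_sq_eq_one_of_map_inv_eq_map_mul h0 h'

end CentralCharacter

/-! ### Step 2: `t ⊗ t = Sym² t + Λ² t`, and `Λ² t = (∏ t) · t⁻¹` in rank `3` -/

section RankinSelbergSquare

/-- `α ⊗ (b :: β) = {a b : a ∈ α} + α ⊗ β`. [folklore] -/
theorem satakeTensor_cons_right_eq (α : Multiset ℂ) (b : ℂ) (β : Multiset ℂ) :
    satakeTensor α (b ::ₘ β) = α.map (· * b) + satakeTensor α β := by
  induction α using Multiset.induction_on with
  | empty => simp
  | cons a α ih =>
    simp only [satakeTensor_cons_left, Multiset.map_cons, ih, Multiset.cons_add]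
    congr 1
    exact add_left_comm _ _ _

/-- `Λ²{a, b, c} = {ab, ac, bc}` (`wedgeTwoParams_cons`, `wedgeTwoParams_pair` of the Kim files). [folklore] -/
theorem wedgeTwoParams_triple (a b c : ℂ) :
    wedgeTwoParams {a, b, c} = {a * b, a * c, b * c} := by
  rw [Multiset.insert_eq_cons, wedgeTwoParams_cons, wedgeTwoParams_pair]
  simp [Multiset.insert_eq_cons]

/-- **`t ⊗ t = Sym² t + Λ² t`** for every multiset `t` — the unramified shadow of
`L(s, Π × Π) = L(s, Π, sym²) L(s, Π, Λ²)` (Ramakrishnan 2014, proof of Theorem A; the eigenvalues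
of `g ⊗ g` are those of `Sym² g` together with those of `Λ² g`). [cite: Ramakrishnan2014, proof of Theorem A] -/
theorem satakeTensor_self_eq_symmSqParams_add_wedgeTwoParams (α : Multiset ℂ) :
    satakeTensor α α = symmSqParams α + wedgeTwoParams α := by
  induction α using Multiset.induction_on with
  | empty => simp [symmSqParams, wedgeTwoParams, satakeTensor]
  | cons a s ih =>
    rw [satakeTensor_cons_left, satakeTensor_cons_right_eq, ih, symmSqParams_cons,
      wedgeTwoParams_cons]
    have hc : s.map (· * a) = s.map (a * ·) := Multiset.map_congr rfl fun x _ => mul_comm x a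
    rw [hc]
    abel

/-- **`Λ² t = (∏ t) · t⁻¹` in rank `3`** — the unramified shadow of `Λ²Π ≃ Π^∨ ⊗ ω_Π` for a
representation `Π` of `GL(3)` (`Λ²` of a `3`-dimensional space is `det ⊗ dual`): for
`t = {a, b, c}` without zero entry, `{ab, ac, bc} = abc · {a⁻¹, b⁻¹, c⁻¹}`.
[cite: Ramakrishnan2014, proof of Theorem A] -/
theorem wedgeTwoParams_eq_map_inv_of_card_eq_three {α : Multiset ℂ} (h3 : Multiset.card α = 3)
    (h0 : (0 : ℂ) ∉ α) :
    wedgeTwoParams α = (α.map fun a => a⁻¹).map (α.prod * ·) := by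
  obtain ⟨a, b, c, rfl⟩ := Multiset.card_eq_three.mp h3
  simp only [Multiset.insert_eq_cons, Multiset.mem_cons, Multiset.mem_singleton, not_or] at h0
  obtain ⟨ha, hb, hc⟩ := h0
  rw [wedgeTwoParams_triple]
  simp only [Multiset.insert_eq_cons, Multiset.map_cons, Multiset.map_singleton, Multiset.prod_cons,
    Multiset.prod_singleton]
  have e1 : a * (b * c) * a⁻¹ = b * c := by field_simp
  have e2 : a * (b * c) * b⁻¹ = a * c := by field_simp
  have e3 : a * (b * c) * c⁻¹ = a * b := by field_simp
  rw [e1, e2, e3, triple_rotate (b * c) (a * c) (a * b), Multiset.cons_swap]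

/-- **The essentially selfdual case: `Λ² t = (e ∏ t) · t`.** If `card t = 3`, `t` has no zero
entry and `{a⁻¹} = {e a}` (shadow of `Π^∨ ≃ Π ⊗ η`, `e = η(ϖ_v)`), then
`Λ² t = (e · ∏ t) · t` — the shadow of `Λ²Π ≃ Π^∨ ⊗ ω ≃ Π ⊗ ηω`; in the selfdual case `e = 1`,
`Λ²Π ≃ Π ⊗ ω` (Ramakrishnan 2014, proof of Theorem A). [cite: Ramakrishnan2014, proof of Theorem A] -/
theorem wedgeTwoParams_eq_map_of_map_inv_eq_map_mul {α : Multiset ℂ} {e : ℂ}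
    (h3 : Multiset.card α = 3) (h0 : (0 : ℂ) ∉ α)
    (h : α.map (fun a => a⁻¹) = α.map (fun a => e * a)) :
    wedgeTwoParams α = α.map (e * α.prod * ·) := by
  rw [wedgeTwoParams_eq_map_inv_of_card_eq_three h3 h0, h, Multiset.map_map]
  exact Multiset.map_congr rfl fun x _ => by simp only [Function.comp_apply]; ring

/-- **`t ⊗ t = Sym² t + (e ∏ t) · t` for an essentially selfdual `GL(3)` parameter** — the
unramified shadow of `L^S(s, Π × Π) = L^S(s, Π, sym²) · L^S(s, Π ⊗ ηω)` for `Π` cuspidal on `GL(3)`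
with `Π^∨ ≃ Π ⊗ η`, the factorisation from which the printed proof extracts the pole of
`L^S(s, Π, sym²)` at `s = 1` (selfdual case `η = 1`: `L^S(s, Π × Π) = L^S(s, Π, sym²) L^S(s, Π ⊗ ω)`).
[cite: Ramakrishnan2014, proof of Theorem A] -/
theorem satakeTensor_self_eq_of_map_inv_eq_map_mul {α : Multiset ℂ} {e : ℂ}
    (h3 : Multiset.card α = 3) (h0 : (0 : ℂ) ∉ α)
    (h : α.map (fun a => a⁻¹) = α.map (fun a => e * a)) :
    satakeTensor α α = symmSqParams α + α.map (e * α.prod * ·) := by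
  rw [satakeTensor_self_eq_symmSqParams_add_wedgeTwoParams,
    wedgeTwoParams_eq_map_of_map_inv_eq_map_mul h3 h0 h]

/-- The selfdual case `e = 1`: `Λ² t = (∏ t) · t` and `t ⊗ t = Sym² t + (∏ t) · t`, with
`(∏ t)² = 1`. [cite: Ramakrishnan2014, proof of Theorem A] -/
theorem satakeTensor_self_eq_of_map_inv_eq_self {α : Multiset ℂ} (h3 : Multiset.card α = 3)
    (h0 : (0 : ℂ) ∉ α) (h : α.map (fun a => a⁻¹) = α) :
    wedgeTwoParams α = α.map (α.prod * ·) ∧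
      satakeTensor α α = symmSqParams α + α.map (α.prod * ·) ∧ α.prod ^ 2 = 1 := by
  have h' : α.map (fun a => a⁻¹) = α.map (fun a => 1 * a) := by simpa using h
  refine ⟨?_, ?_, prod_sq_eq_one_of_map_inv_eq_self h0 h⟩
  · simpa using wedgeTwoParams_eq_map_of_map_inv_eq_map_mul h3 h0 h'
  · simpa using satakeTensor_self_eq_of_map_inv_eq_map_mul h3 h0 h'

end RankinSelbergSquare

/-! ### Steps 1–2 for a cuspidal Borel–Jacquet datum on `GL₃(𝔸_F)` -/

namespace Ramakrishnan2014_selfdualGL3_adjointLift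

variable {F : Type} [Field F] [NumberField F] {hF3 : isCompact_glFiniteIntegralLevel 3 F}

/-- **Steps 1–2 of the printed proof in the Borel–Jacquet model.** Under the hypothesis of
`Ramakrishnan2014_selfdualGL3_adjointLift` (the unramified shadow of `Π^∨ ≃ Π ⊗ η`), at almost
every finite place `v` every Satake parameter `α = t_{Π,v}` of `Π` without zero entry satisfies
`η(ϖ_v)³ (∏ α)² = 1` (central characters: `η³ ω_Π² = 1`), `Λ² α = (η(ϖ_v) ∏ α) · α`
(`Λ²Π ≃ Π ⊗ ηω_Π`) and `α ⊗ α = Sym² α + (η(ϖ_v) ∏ α) · α`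
(`L^S(s, Π × Π) = L^S(s, Π, sym²) L^S(s, Π ⊗ ηω_Π)`); `card α = 3` is part of `HasSatakeParamAt`.
[cite: Ramakrishnan2014, proof of Theorem A] [cite: Shavali2026, Lemma 4.7 (proof)] -/
theorem eventually_shadow (P : CuspidalAutomorphicRepData 3 F hF3) (η : HeckeCharacter F)
    (hsd : ∀ᶠ v : HeightOneSpectrum (𝓞 F) in Filter.cofinite, ∀ α : Multiset ℂ,
      P.1.HasSatakeParamAt v α →
        η.IsUnramifiedAt v ∧
          α.map (fun a => a⁻¹) = α.map (fun a => η.valueAtUniformizer v * a)) :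
    ∀ᶠ v : HeightOneSpectrum (𝓞 F) in Filter.cofinite, ∀ α : Multiset ℂ,
      P.1.HasSatakeParamAt v α → (0 : ℂ) ∉ α →
        η.valueAtUniformizer v ^ 3 * α.prod ^ 2 = 1 ∧
        wedgeTwoParams α = α.map (η.valueAtUniformizer v * α.prod * ·) ∧
        satakeTensor α α = symmSqParams α + α.map (η.valueAtUniformizer v * α.prod * ·) := by
  filter_upwards [hsd] with v hv α hα h0
  have h3 : Multiset.card α = 3 := hα.card_eq
  obtain ⟨-, h⟩ := hv α hα
  exact ⟨h3 ▸ pow_card_mul_prod_sq_eq_one_of_map_inv_eq_map_mul h0 h,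
    wedgeTwoParams_eq_map_of_map_inv_eq_map_mul h3 h0 h,
    satakeTensor_self_eq_of_map_inv_eq_map_mul h3 h0 h⟩

/-- The selfdual case (`η = 1`, Theorem A as printed): a.e. `(∏ t_{Π,v})² = 1` (`ω_Π² = 1`),
`Λ² t_{Π,v} = ω_Π(ϖ_v) t_{Π,v}` and `t_{Π,v} ⊗ t_{Π,v} = Sym² t_{Π,v} + ω_Π(ϖ_v) t_{Π,v}`.
[cite: Ramakrishnan2014, proof of Theorem A] -/
theorem eventually_shadow_selfdual (P : CuspidalAutomorphicRepData 3 F hF3)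
    (hsd : ∀ᶠ v : HeightOneSpectrum (𝓞 F) in Filter.cofinite, ∀ α : Multiset ℂ,
      P.1.HasSatakeParamAt v α → α.map (fun a => a⁻¹) = α) :
    ∀ᶠ v : HeightOneSpectrum (𝓞 F) in Filter.cofinite, ∀ α : Multiset ℂ,
      P.1.HasSatakeParamAt v α → (0 : ℂ) ∉ α →
        α.prod ^ 2 = 1 ∧ wedgeTwoParams α = α.map (α.prod * ·) ∧
        satakeTensor α α = symmSqParams α + α.map (α.prod * ·) := by
  filter_upwards [hsd] with v hv α hα h0
  obtain ⟨h1, h2, h3⟩ := satakeTensor_self_eq_of_map_inv_eq_self hα.card_eq h0 (hv α hα)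
  exact ⟨h3, h1, h2⟩

end Ramakrishnan2014_selfdualGL3_adjointLift

/-! ### Satake parameters of Borel–Jacquet data have no zero entry -/

section ZeroNotMem

variable {n : ℕ} {K : Type} [Field K] [NumberField K] {hcpt : isCompact_glFiniteIntegralLevel n K}

/-- **`e_n(t_{π,v}) = ∏ t_{π,v} ≠ 0`** for every Satake parameter of an automorphic representation
`π = W / W'` of `GL_n(𝔸_K)` in the Borel–Jacquet model (`AutomorphicRepData.HasSatakeParamAt`):
the top Hecke operator `T_{v,n} = [K(𝔫) t_{v,n} K(𝔫)]` is right translation by the *central*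
element `t_{v,n} = ϖ_v · 1_n` on `K(𝔫)`-fixed forms (`heckeOperator_apply_of_mem_center`,
`heckeDiagAt_self_mem_center`), an invertible operator preserving `W'`, and its eigenvalue modulo
`W'` on the eigenform `φ ∉ W'` is `q_v⁰ e_n(α) = ∏ α`; so `∏ α = 0` would put `r(t_{v,n}) φ`,
hence `φ`, in `W'`. (The `L²`-model counterpart is `HasSatakeParameterAt.esymm_ne_zero` of
`AutomorphicTwistSatake`; Bump 1997, §3.3: `T_{v,n} = R(ϖ_v · 1_n)`.) [folklore] -/
theorem AutomorphicRepData.HasSatakeParamAt.prod_ne_zero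
    {π : AutomorphicRepData (AutomorphyDatum.gl n K hcpt)} {v : HeightOneSpectrum (𝓞 K)}
    {α : Multiset ℂ} (h : π.HasSatakeParamAt v α) : α.prod ≠ 0 := by
  obtain ⟨𝔫, ϖ, -, -, -, hcard, φ, -, hφW', hfix, heig⟩ := h
  intro h0
  have key := heig n le_rfl
  have hes : α.esymm n = α.prod := by
    rw [← hcard, Multiset.esymm, Multiset.powersetCard_self, Multiset.map_singleton,
      Multiset.sum_singleton]
  have hφK : φ ∈ (rightTranslation (AdelicGroupData.gl n K)).fixedPoints
      (principalCongruenceLevel n K 𝔫) :=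
    (isRightInvariantUnder_iff_mem_fixedPoints _ _ _).mp fun u hu x => congrFun (hfix u hu) x
  have e : heckeOperator (rightTranslation (AdelicGroupData.gl n K))
      (principalCongruenceLevel n K 𝔫) (heckeDiagAt n K v ϖ n) φ =
      rightTranslation (AdelicGroupData.gl n K) (heckeDiagAt n K v ϖ n) φ :=
    heckeOperator_apply_of_mem_center _ _ (heckeDiagAt_self_mem_center v ϖ) hφK
  rw [hes, h0, mul_zero, zero_smul, sub_zero, e] at key
  have ht : heckeDiagAt n K v ϖ n ∈ (AutomorphyDatum.gl n K hcpt).finiteAdelic := by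
    rw [heckeDiagAt_eq_ofLocal]
    exact GLn.ofLocal_mem_range_ofFinite v _
  apply hφW'
  have e' : φ = rightTranslation (AdelicGroupData.gl n K) (heckeDiagAt n K v ϖ n)⁻¹
      (rightTranslation (AdelicGroupData.gl n K) (heckeDiagAt n K v ϖ n) φ) := by
    rw [← Module.End.mul_apply, ← map_mul, inv_mul_cancel, map_one, Module.End.one_apply]
  rw [e']
  exact π.stable'.finite_stable _ (inv_mem ht) key

/-- **All entries of a Satake parameter of a Borel–Jacquet datum are non-zero** (`∏ α ≠ 0`).
[folklore] -/
theorem AutomorphicRepData.HasSatakeParamAt.zero_not_mem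
    {π : AutomorphicRepData (AutomorphyDatum.gl n K hcpt)} {v : HeightOneSpectrum (𝓞 K)}
    {α : Multiset ℂ} (h : π.HasSatakeParamAt v α) : (0 : ℂ) ∉ α :=
  fun h0 => h.prod_ne_zero (Multiset.prod_eq_zero h0)

end ZeroNotMem

namespace Ramakrishnan2014_selfdualGL3_adjointLift

variable {F : Type} [Field F] [NumberField F] {hF3 : isCompact_glFiniteIntegralLevel 3 F}

/-- **Steps 1–2 of the printed proof in the Borel–Jacquet model, unconditionally** (the entries
of a Satake parameter are non-zero, `AutomorphicRepData.HasSatakeParamAt.zero_not_mem`): under the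
hypothesis of `Ramakrishnan2014_selfdualGL3_adjointLift`, at almost every `v` every Satake
parameter `α` of `Π` at `v` satisfies `η(ϖ_v)³ (∏ α)² = 1`, `Λ² α = (η(ϖ_v) ∏ α) · α` and
`α ⊗ α = Sym² α + (η(ϖ_v) ∏ α) · α`.
[cite: Ramakrishnan2014, proof of Theorem A] [cite: Shavali2026, Lemma 4.7 (proof)] -/
theorem ae_shadow (P : CuspidalAutomorphicRepData 3 F hF3) (η : HeckeCharacter F)
    (hsd : ∀ᶠ v : HeightOneSpectrum (𝓞 F) in Filter.cofinite, ∀ α : Multiset ℂ,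
      P.1.HasSatakeParamAt v α →
        η.IsUnramifiedAt v ∧
          α.map (fun a => a⁻¹) = α.map (fun a => η.valueAtUniformizer v * a)) :
    ∀ᶠ v : HeightOneSpectrum (𝓞 F) in Filter.cofinite, ∀ α : Multiset ℂ,
      P.1.HasSatakeParamAt v α →
        η.valueAtUniformizer v ^ 3 * α.prod ^ 2 = 1 ∧
        wedgeTwoParams α = α.map (η.valueAtUniformizer v * α.prod * ·) ∧
        satakeTensor α α = symmSqParams α + α.map (η.valueAtUniformizer v * α.prod * ·) := by
  filter_upwards [eventually_shadow P η hsd] with v hv α hα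
  exact hv α hα hα.zero_not_mem

/-- The selfdual case, unconditionally: a.e. `(∏ t_{Π,v})² = 1`, `Λ² t_{Π,v} = ω_Π(ϖ_v) t_{Π,v}`,
`t_{Π,v} ⊗ t_{Π,v} = Sym² t_{Π,v} + ω_Π(ϖ_v) t_{Π,v}` (`ω_Π(ϖ_v) = ∏ t_{Π,v}`).
[cite: Ramakrishnan2014, proof of Theorem A] -/
theorem ae_shadow_selfdual (P : CuspidalAutomorphicRepData 3 F hF3)
    (hsd : ∀ᶠ v : HeightOneSpectrum (𝓞 F) in Filter.cofinite, ∀ α : Multiset ℂ,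
      P.1.HasSatakeParamAt v α → α.map (fun a => a⁻¹) = α) :
    ∀ᶠ v : HeightOneSpectrum (𝓞 F) in Filter.cofinite, ∀ α : Multiset ℂ,
      P.1.HasSatakeParamAt v α →
        α.prod ^ 2 = 1 ∧ wedgeTwoParams α = α.map (α.prod * ·) ∧
        satakeTensor α α = symmSqParams α + α.map (α.prod * ·) := by
  filter_upwards [eventually_shadow_selfdual P hsd] with v hv α hα
  exact hv α hα hα.zero_not_mem

end Ramakrishnan2014_selfdualGL3_adjointLift

/-! ### `Ad(β)` is selfdual: bookkeeping on `adParams` -/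

section AdParams

/-- `{a b⁻¹ : (a, b) ∈ β × γ}⁻¹ = {b a⁻¹ : (b, a) ∈ γ × β}`: inverting Rankin–Selberg data swaps
the factors. [folklore] -/
theorem rsData_map_inv (β γ : Multiset ℂ) :
    (rsData β γ).map (fun x => x⁻¹) = rsData γ β := by
  rw [rsData, rsData, ← Multiset.map_swap_product γ β, Multiset.map_map, Multiset.map_map]
  refine Multiset.map_congr rfl fun p _ => ?_
  simp only [Function.comp_apply, Prod.fst_swap, Prod.snd_swap, mul_inv_rev, inv_inv]

/-- **`Ad(β)⁻¹ = Ad(β)`**: the adjoint parameter is selfdual (`{x/y, y/x, 1}` is stable under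
inversion; in general `uv⁻¹ ↦ vu⁻¹` permutes the quotients). [folklore] -/
theorem adParams_map_inv (β : Multiset ℂ) :
    (adParams β).map (fun x => x⁻¹) = adParams β := by
  have h : ((β ×ˢ β).map fun p : ℂ × ℂ => p.1 * p.2⁻¹).map (fun x => x⁻¹) =
      (β ×ˢ β).map fun p : ℂ × ℂ => p.1 * p.2⁻¹ := rsData_map_inv β β
  rw [adParams, Multiset.map_erase _ inv_injective, inv_one, h]

/-- `Ad(β)` has no zero entry if `β` has none. [folklore] -/
theorem zero_not_mem_adParams {β : Multiset ℂ} (h0 : (0 : ℂ) ∉ β) : (0 : ℂ) ∉ adParams β := by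
  intro h
  obtain ⟨p, hp, hp0⟩ := Multiset.mem_map.mp (Multiset.mem_of_mem_erase h)
  obtain ⟨h1, h2⟩ := Multiset.mem_product.mp hp
  rcases mul_eq_zero.mp hp0 with h | h
  · exact h0 (h ▸ h1)
  · exact h0 ((inv_eq_zero.mp h) ▸ h2)

/-- `∏ Ad{x, y} = (x/y)(y/x) · 1 = 1`. [folklore] -/
theorem prod_adParams_pair {x y : ℂ} (hx : x ≠ 0) (hy : y ≠ 0) : (adParams {x, y}).prod = 1 := by
  rw [adParams_pair hx hy]
  simp only [Multiset.insert_eq_cons, Multiset.prod_cons, Multiset.prod_singleton]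
  field_simp

/-- `card Ad{x, y} = 3`. [folklore] -/
theorem card_adParams_pair {x y : ℂ} (hx : x ≠ 0) (hy : y ≠ 0) :
    Multiset.card (adParams {x, y}) = 3 := by
  rw [adParams_pair hx hy]
  simp

/-- **The twist `c · Ad(β)` is essentially selfdual with multiplier `c⁻²`**:
`{(c a)⁻¹ : a ∈ Ad(β)} = {c⁻² (c a) : a ∈ Ad(β)}` — the unramified shadow of
`(Ad(π) ⊗ ν)^∨ ≅ (Ad(π) ⊗ ν) ⊗ ν⁻²`. [folklore] -/
theorem map_inv_adParams_twist (β : Multiset ℂ) {c : ℂ} (hc : c ≠ 0) :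
    ((adParams β).map (c * ·)).map (fun x => x⁻¹) =
      ((adParams β).map (c * ·)).map ((c ^ 2)⁻¹ * ·) := by
  calc ((adParams β).map (c * ·)).map (fun x => x⁻¹)
      = ((adParams β).map (fun x => x⁻¹)).map (c⁻¹ * ·) := by
          rw [Multiset.map_map, Multiset.map_map]
          exact Multiset.map_congr rfl fun x _ => by simp only [Function.comp_apply, mul_inv]
    _ = (adParams β).map (c⁻¹ * ·) := by rw [adParams_map_inv]
    _ = ((adParams β).map (c * ·)).map ((c ^ 2)⁻¹ * ·) := by
          rw [Multiset.map_map]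
          refine Multiset.map_congr rfl fun x _ => ?_
          simp only [Function.comp_apply]
          rw [pow_two, mul_inv, ← mul_assoc, inv_mul_cancel_right₀ hc]

/-- `∏ (c · Ad{x, y}) = c³`. [folklore] -/
theorem prod_adParams_twist_pair {x y : ℂ} (c : ℂ) (hx : x ≠ 0) (hy : y ≠ 0) :
    ((adParams {x, y}).map (c * ·)).prod = c ^ 3 := by
  rw [Multiset.prod_map_mul, Multiset.map_const', Multiset.prod_replicate, Multiset.map_id',
    card_adParams_pair hx hy, prod_adParams_pair hx hy, mul_one]

end AdParams

/-! ### The converse half of Shavali's Lemma 4.7 and "`ν` is the central character of `Π`" -/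

namespace Ramakrishnan2014_selfdualGL3_adjointLift

variable {F : Type} [Field F] [NumberField F] {hF2 : isCompact_glFiniteIntegralLevel 2 F}
  {hF3 : isCompact_glFiniteIntegralLevel 3 F}

/-- **Adjoint lifts are essentially selfdual** — the converse ("only if") half of Shavali 2026,
Lemma 4.7 ("`π` is essentially `sym²` if and only if there exist a Hecke character `χ` such that
`π = π^∨ ⊗ χ`"), on Satake parameters and unconditionally: if `t_{Π,v} = ν(ϖ_v) Ad(t_{π,v})` at
almost every `v` at which `π` is unramified (the conclusion of
`Ramakrishnan2014_selfdualGL3_adjointLift`, for any automorphic `Π` on `GL₃(𝔸_F)`, `π` on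
`GL₂(𝔸_F)` in the Borel–Jacquet model), then `t_{Π,v}⁻¹ = ν⁻²(ϖ_v) t_{Π,v}` for every Satake
parameter of `Π` at almost every `v` — the unramified shadow of `Π^∨ ≅ Π ⊗ ν⁻²`, i.e. the
hypothesis of the named fact with `η = ν⁻²` (`Ad(t)` is selfdual, `adParams_map_inv`; `π` is
unramified almost everywhere and Satake parameters of `Π` are unique, Flath:
`hasSatakeParamAt_cofinite_holds`, `hasSatakeParamAt_unique_holds`).
[cite: Shavali2026, Lemma 4.7] [cite: Ramakrishnan2014, Theorem A] -/
theorem converse {P : AutomorphicRepData (AutomorphyDatum.gl 3 F hF3)}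
    {π : AutomorphicRepData (AutomorphyDatum.gl 2 F hF2)} {ν : HeckeCharacter F}
    (hsat : ∀ᶠ v : HeightOneSpectrum (𝓞 F) in Filter.cofinite, ∀ β : Multiset ℂ,
      π.HasSatakeParamAt v β →
        ν.IsUnramifiedAt v ∧
          P.HasSatakeParamAt v ((adParams β).map fun c => ν.valueAtUniformizer v * c)) :
    ∀ᶠ v : HeightOneSpectrum (𝓞 F) in Filter.cofinite, ∀ α : Multiset ℂ,
      P.HasSatakeParamAt v α →
        (ν ^ 2)⁻¹.IsUnramifiedAt v ∧
          α.map (fun a => a⁻¹) = α.map (fun a => (ν ^ 2)⁻¹.valueAtUniformizer v * a) := by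
  filter_upwards [hsat, π.hasSatakeParamAt_cofinite_holds,
    GaloisRepresentations.HeckeCharacter.isUnramifiedAt_cofinite_holds (ν ^ 2)⁻¹]
    with v hv hunr hν2 α hα
  obtain ⟨β, hβ⟩ := hunr
  obtain ⟨-, hPv⟩ := hv β hβ
  have hαβ : α = (adParams β).map (fun c => ν.valueAtUniformizer v * c) :=
    P.hasSatakeParamAt_unique_holds hα hPv
  refine ⟨hν2, ?_⟩
  rw [hαβ, heckeCharacter_valueAtUniformizer_inv, heckeCharacter_valueAtUniformizer_sq]
  exact map_inv_adParams_twist β (heckeCharacter_valueAtUniformizer_ne_zero ν v)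

/-- The case `ν² = 1` of the converse (Theorem A: "`Π ≃ Ad(π) ⊗ ν` with `ν² = 1`" forces
`Π^∨ ≃ Π`): a.e. `t_{Π,v}⁻¹ = t_{Π,v}`. [cite: Ramakrishnan2014, Theorem A] -/
theorem converse_selfdual {P : AutomorphicRepData (AutomorphyDatum.gl 3 F hF3)}
    {π : AutomorphicRepData (AutomorphyDatum.gl 2 F hF2)} {ν : HeckeCharacter F} (hν : ν ^ 2 = 1)
    (hsat : ∀ᶠ v : HeightOneSpectrum (𝓞 F) in Filter.cofinite, ∀ β : Multiset ℂ,
      π.HasSatakeParamAt v β →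
        ν.IsUnramifiedAt v ∧
          P.HasSatakeParamAt v ((adParams β).map fun c => ν.valueAtUniformizer v * c)) :
    ∀ᶠ v : HeightOneSpectrum (𝓞 F) in Filter.cofinite, ∀ α : Multiset ℂ,
      P.HasSatakeParamAt v α → α.map (fun a => a⁻¹) = α := by
  filter_upwards [converse hsat] with v hv α hα
  have h := (hv α hα).2
  rw [hν, inv_one, one_valueAtUniformizer] at h
  simpa using h

/-- **"`ν` is simply the central character of `Π`"** (Theorem A), unramified shadow: if
`t_{Π,v} = ν(ϖ_v) Ad(t_{π,v})` a.e. then `ν(ϖ_v)³ = ∏ t_{Π,v}` (`= ω_Π(ϖ_v)`) for every Satake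
parameter of `Π` at almost every `v` (`∏ Ad{x, y} = 1`); with `ν² = 1` this reads
`ν(ϖ_v) = ω_Π(ϖ_v)` (`valueAtUniformizer_eq_prod`). [cite: Ramakrishnan2014, Theorem A] -/
theorem valueAtUniformizer_pow_three_eq_prod {P : AutomorphicRepData (AutomorphyDatum.gl 3 F hF3)}
    {π : AutomorphicRepData (AutomorphyDatum.gl 2 F hF2)} {ν : HeckeCharacter F}
    (hsat : ∀ᶠ v : HeightOneSpectrum (𝓞 F) in Filter.cofinite, ∀ β : Multiset ℂ,
      π.HasSatakeParamAt v β →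
        ν.IsUnramifiedAt v ∧
          P.HasSatakeParamAt v ((adParams β).map fun c => ν.valueAtUniformizer v * c)) :
    ∀ᶠ v : HeightOneSpectrum (𝓞 F) in Filter.cofinite, ∀ α : Multiset ℂ,
      P.HasSatakeParamAt v α → ν.valueAtUniformizer v ^ 3 = α.prod := by
  filter_upwards [hsat, π.hasSatakeParamAt_cofinite_holds] with v hv hunr α hα
  obtain ⟨β, hβ⟩ := hunr
  obtain ⟨-, hPv⟩ := hv β hβ
  have hαβ : α = (adParams β).map (fun c => ν.valueAtUniformizer v * c) :=
    P.hasSatakeParamAt_unique_holds hα hPv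
  have h0 := hβ.zero_not_mem
  obtain ⟨x, y, rfl⟩ := Multiset.card_eq_two.mp hβ.card_eq
  have hx : x ≠ 0 := fun h => h0 (by simp [h])
  have hy : y ≠ 0 := fun h => h0 (by simp [h])
  rw [hαβ, prod_adParams_twist_pair _ hx hy]

/-- With `ν² = 1`: `ν(ϖ_v) = ∏ t_{Π,v} = ω_Π(ϖ_v)` a.e. — "`ν` is simply the central character of
`Π`" (Theorem A). [cite: Ramakrishnan2014, Theorem A] -/
theorem valueAtUniformizer_eq_prod {P : AutomorphicRepData (AutomorphyDatum.gl 3 F hF3)}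
    {π : AutomorphicRepData (AutomorphyDatum.gl 2 F hF2)} {ν : HeckeCharacter F} (hν : ν ^ 2 = 1)
    (hsat : ∀ᶠ v : HeightOneSpectrum (𝓞 F) in Filter.cofinite, ∀ β : Multiset ℂ,
      π.HasSatakeParamAt v β →
        ν.IsUnramifiedAt v ∧
          P.HasSatakeParamAt v ((adParams β).map fun c => ν.valueAtUniformizer v * c)) :
    ∀ᶠ v : HeightOneSpectrum (𝓞 F) in Filter.cofinite, ∀ α : Multiset ℂ,
      P.HasSatakeParamAt v α → ν.valueAtUniformizer v = α.prod := by
  filter_upwards [valueAtUniformizer_pow_three_eq_prod hsat] with v hv α hα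
  have h2 : ν.valueAtUniformizer v ^ 2 = 1 := by
    rw [← heckeCharacter_valueAtUniformizer_sq, hν, one_valueAtUniformizer]
  rw [← hv α hα, pow_succ, h2, one_mul]

/-! ### Step 6 of the printed proof: the essentially selfdual case from the selfdual case -/

/-- **Reduction of the named fact to Theorem A as printed (the selfdual case `η = 1`), granted the
Satake shadow of central characters on `GL₃`** — the twisting argument of the remark following
Theorem A (Ramakrishnan 2014, p. 777: "Theorem A remains valid for any cusp form `Π` on `GL(3)/F`
which satisfies `Π^∨ ≃ Π ⊗ |·|^t` … we may replace `Π` by `Π ⊗ |·|^{t/2}`, which is selfdual")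
and of the proof of Shavali 2026, Lemma 4.7 ("comparing central characters we have `χ³ = ω²`.
Therefore `χ = (ω χ⁻¹)²` has a square root. By twisting out this square root we can assume that
`π` is self-dual. Now the result follows from [Ramakrishnan 2014]"), for Borel–Jacquet data:
let `Ω` be a Hecke character with `Ω(ϖ_v) = ∏ t_{Π,v}` a.e. (hypothesis `hΩ`, the central
character of `Π`); the shadow `η(ϖ_v)³ (∏ t_{Π,v})² = 1` (`ae_shadow`) and the rigidity of Hecke
characters (`HeckeCharacter.ext_of_eventually_valueAtUniformizer_eq`, Cassels–Fröhlich VII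
Prop. 4.1) give `μ² = η` for `μ := (Ω η)⁻¹`; the twist `Π ⊗ (μ ∘ det)`
(`CuspidalAutomorphicRepData.exists_twist_hecke_hasSatakeParamAt`, `t_{Π ⊗ μ,v} = μ(ϖ_v) t_{Π,v}`)
is selfdual on Satake parameters (`(μ t)⁻¹ = μ⁻¹ η t = μ t`); Theorem A (hypothesis `hA`) gives
`Π ⊗ μ ≃ Ad(π) ⊗ ν₁`, `ν₁² = 1`, `π` non-dihedral; and `ν := ν₁ μ⁻¹` has `ν² η = μ⁻² η = 1` and
`t_{Π,v} = ν(ϖ_v) Ad(t_{π,v})` a.e. (uniqueness of Satake parameters and unramifiedness a.e.,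
Flath: `hasSatakeParamAt_unique_holds`, `hasSatakeParamAt_cofinite_holds`).
[cite: Ramakrishnan2014, Theorem A and the remark following it, p. 777]
[cite: Shavali2026, Lemma 4.7 (proof)] -/
theorem of_selfdual_of_centralCharacter
    (hA : ∀ (F : Type) [Field F] [NumberField F] (hF2 : isCompact_glFiniteIntegralLevel 2 F)
      (hF3 : isCompact_glFiniteIntegralLevel 3 F) (P : CuspidalAutomorphicRepData 3 F hF3),
      (∀ᶠ v : HeightOneSpectrum (𝓞 F) in Filter.cofinite, ∀ α : Multiset ℂ,
          P.1.HasSatakeParamAt v α → α.map (fun a => a⁻¹) = α) →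
      ∃ (π : CuspidalAutomorphicRepData 2 F hF2) (ν : HeckeCharacter F),
        (∀ (K : Type) [Field K] [NumberField K] [Algebra F K], Module.finrank F K = 2 →
            ¬ IsQuadraticSelfTwistAE K π.1) ∧
        ν ^ 2 = 1 ∧
        ∀ᶠ v : HeightOneSpectrum (𝓞 F) in Filter.cofinite, ∀ β : Multiset ℂ,
          π.1.HasSatakeParamAt v β →
            ν.IsUnramifiedAt v ∧
              P.1.HasSatakeParamAt v ((adParams β).map fun c => ν.valueAtUniformizer v * c))
    (hΩ : ∀ (F : Type) [Field F] [NumberField F] (hF3 : isCompact_glFiniteIntegralLevel 3 F)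
      (P : CuspidalAutomorphicRepData 3 F hF3),
      ∃ Ω : HeckeCharacter F, ∀ᶠ v : HeightOneSpectrum (𝓞 F) in Filter.cofinite,
        ∀ α : Multiset ℂ, P.1.HasSatakeParamAt v α → Ω.valueAtUniformizer v = α.prod) :
    Ramakrishnan2014_selfdualGL3_adjointLift := by
  intro F _ _ hF2 hF3 P η hsd
  obtain ⟨Ω, hΩP⟩ := hΩ F hF3 P
  -- `μ := (Ω η)⁻¹` (kept opaque)
  obtain ⟨μ, hμdef⟩ : ∃ μ : HeckeCharacter F, μ = (Ω * η)⁻¹ := ⟨_, rfl⟩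
  have hμv : ∀ v : HeightOneSpectrum (𝓞 F), μ.valueAtUniformizer v =
      (Ω.valueAtUniformizer v * η.valueAtUniformizer v)⁻¹ := fun v => by
    rw [hμdef, heckeCharacter_valueAtUniformizer_inv,
      GaloisRepresentations.HeckeCharacter.valueAtUniformizer_mul]
  -- `μ(ϖ_v)² = η(ϖ_v)` a.e., from `η³ ω² = 1` (step 1)
  have hμ2v : ∀ᶠ v : HeightOneSpectrum (𝓞 F) in Filter.cofinite,
      μ.valueAtUniformizer v ^ 2 = η.valueAtUniformizer v := by
    filter_upwards [ae_shadow P η hsd, hΩP, P.1.hasSatakeParamAt_cofinite_holds] with v hv hΩv hunr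
    obtain ⟨α, hα⟩ := hunr
    have h1 : η.valueAtUniformizer v ^ 3 * α.prod ^ 2 = 1 := (hv α hα).1
    rw [← hΩv α hα] at h1
    have hΩ0 := heckeCharacter_valueAtUniformizer_ne_zero Ω v
    have hη0 := heckeCharacter_valueAtUniformizer_ne_zero η v
    rw [hμv, inv_pow, eq_comm, ← mul_eq_one_iff_eq_inv₀ (pow_ne_zero _ (mul_ne_zero hΩ0 hη0))]
    linear_combination h1
  -- hence `μ² = η` (rigidity of Hecke characters)
  have hμ2 : μ ^ 2 = η :=
    GaloisRepresentations.HeckeCharacter.ext_of_eventually_valueAtUniformizer_eq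
      (hμ2v.mono fun v hv => by rw [heckeCharacter_valueAtUniformizer_sq, hv])
  -- the twist `Π' = Π ⊗ (μ ∘ det)` and its Satake parameters
  obtain ⟨P', hP'⟩ := CuspidalAutomorphicRepData.exists_twist_hecke_hasSatakeParamAt μ P
  -- `Π'` is selfdual on Satake parameters
  have hsd' : ∀ᶠ v : HeightOneSpectrum (𝓞 F) in Filter.cofinite, ∀ α' : Multiset ℂ,
      P'.1.HasSatakeParamAt v α' → α'.map (fun a => a⁻¹) = α' := by
    filter_upwards [hsd, hP', hμ2v, P.1.hasSatakeParamAt_cofinite_holds]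
      with v hv hPv hμv2 hunr α' hα'
    obtain ⟨α, hα⟩ := hunr
    have hα'eq : α' = α.map (μ.valueAtUniformizer v * ·) :=
      P'.1.hasSatakeParamAt_unique_holds hα' (hPv α hα)
    obtain ⟨-, hinv⟩ := hv α hα
    have hμ0 := heckeCharacter_valueAtUniformizer_ne_zero μ v
    rw [hα'eq]
    calc (α.map (μ.valueAtUniformizer v * ·)).map (fun a => a⁻¹)
        = (α.map (fun a => a⁻¹)).map ((μ.valueAtUniformizer v)⁻¹ * ·) := by
            rw [Multiset.map_map, Multiset.map_map]
            exact Multiset.map_congr rfl fun x _ => by simp only [Function.comp_apply, mul_inv]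
      _ = α.map (μ.valueAtUniformizer v * ·) := by
            rw [hinv, Multiset.map_map]
            refine Multiset.map_congr rfl fun x _ => ?_
            simp only [Function.comp_apply]
            rw [← hμv2, pow_two, ← mul_assoc, ← mul_assoc, inv_mul_cancel₀ hμ0, one_mul]
  -- Theorem A for `Π'`
  obtain ⟨π, ν₁, hnd, hν₁, hsat₁⟩ := hA F hF2 hF3 P' hsd'
  refine ⟨π, ν₁ * μ⁻¹, hnd, ?_, ?_⟩
  · rw [mul_pow, hν₁, one_mul, inv_pow, hμ2, inv_mul_cancel]
  · filter_upwards [hsat₁, hP', P.1.hasSatakeParamAt_cofinite_holds,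
      GaloisRepresentations.HeckeCharacter.isUnramifiedAt_cofinite_holds (ν₁ * μ⁻¹)]
      with v hv hPv hunr hνv β hβ
    refine ⟨hνv, ?_⟩
    obtain ⟨-, hP'v⟩ := hv β hβ
    obtain ⟨α, hα⟩ := hunr
    have heq : (adParams β).map (fun c => ν₁.valueAtUniformizer v * c) =
        α.map (μ.valueAtUniformizer v * ·) :=
      P'.1.hasSatakeParamAt_unique_holds hP'v (hPv α hα)
    have hμ0 := heckeCharacter_valueAtUniformizer_ne_zero μ v
    have e1 : (α.map (μ.valueAtUniformizer v * ·)).map ((μ.valueAtUniformizer v)⁻¹ * ·) = α := by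
      rw [Multiset.map_map]
      refine (Multiset.map_congr rfl fun x _ => ?_).trans (Multiset.map_id' α)
      simp only [Function.comp_apply]
      rw [← mul_assoc, inv_mul_cancel₀ hμ0, one_mul]
    have hα' : α = (adParams β).map (fun c => (ν₁ * μ⁻¹).valueAtUniformizer v * c) := by
      rw [← e1, ← heq, Multiset.map_map]
      refine Multiset.map_congr rfl fun x _ => ?_
      simp only [Function.comp_apply]
      rw [GaloisRepresentations.HeckeCharacter.valueAtUniformizer_mul,
        heckeCharacter_valueAtUniformizer_inv]
      ring
    rw [hα'] at hα
    exact hα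

/-- **The named fact from Theorem A as printed and the Borel–Jacquet dictionary at rank `3`.**
The hypothesis `hΩ` of `of_selfdual_of_centralCharacter` (a Hecke character with
`Ω(ϖ_v) = ∏ t_{Π,v}` a.e., for every cuspidal `Π` on `GL₃(𝔸_F)`) is supplied by
`exists_heckeCharacter_prod_satake_of_sSup_irreducible` (`CuspidalDescentDetCubicRepData`: the
central character of the unitary normalisation of `Π`, Borel–Jacquet 1979, 5.7) granted the three
named leaves of the Borel–Jacquet dictionary at rank `3` — `AutomorphicRepsGL.exists_isAssociatedL2`,
`hasSatakeParamAt_iff_L2`, `AutomorphicRepsGL.stable_cuspidal_eq_sSup_irreducible` — for an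
automorphic measure on `GL₃(F) A_G \ GL₃(𝔸_F)`, which exists
(`AdelicGroupData.exists_isAutomorphicMeasure_gl_holds`, Borel–Harish-Chandra). So what separates
`Ramakrishnan2014_selfdualGL3_adjointLift` from these leaves is exactly Theorem A for selfdual `Π`
(hypothesis `hA`: the pole of `L^S(s, Π, sym²)`, the descent `GL(3) → SL(2)` and Labesse–Langlands).
[cite: Ramakrishnan2014, Theorem A and the remark following it, p. 777]
[cite: Shavali2026, Lemma 4.7 (proof)] [cite: BorelJacquetCorvallis1979, §4.6 and 5.7] -/
theorem of_selfdual_of_leaves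
    (hA : ∀ (F : Type) [Field F] [NumberField F] (hF2 : isCompact_glFiniteIntegralLevel 2 F)
      (hF3 : isCompact_glFiniteIntegralLevel 3 F) (P : CuspidalAutomorphicRepData 3 F hF3),
      (∀ᶠ v : HeightOneSpectrum (𝓞 F) in Filter.cofinite, ∀ α : Multiset ℂ,
          P.1.HasSatakeParamAt v α → α.map (fun a => a⁻¹) = α) →
      ∃ (π : CuspidalAutomorphicRepData 2 F hF2) (ν : HeckeCharacter F),
        (∀ (K : Type) [Field K] [NumberField K] [Algebra F K], Module.finrank F K = 2 →
            ¬ IsQuadraticSelfTwistAE K π.1) ∧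
        ν ^ 2 = 1 ∧
        ∀ᶠ v : HeightOneSpectrum (𝓞 F) in Filter.cofinite, ∀ β : Multiset ℂ,
          π.1.HasSatakeParamAt v β →
            ν.IsUnramifiedAt v ∧
              P.1.HasSatakeParamAt v ((adParams β).map fun c => ν.valueAtUniformizer v * c))
    (hAss : ∀ (F : Type) [Field F] [NumberField F] (hF3 : isCompact_glFiniteIntegralLevel 3 F)
      (μm : _root_.MeasureTheory.Measure (AdelicGroupData.gl 3 F).automorphicQuotient)
      [(AdelicGroupData.gl 3 F).IsAutomorphicMeasure μm],
      AutomorphicRepsGL.exists_isAssociatedL2 hF3 μm)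
    (hL2 : ∀ (F : Type) [Field F] [NumberField F] (hF3 : isCompact_glFiniteIntegralLevel 3 F)
      (μm : _root_.MeasureTheory.Measure (AdelicGroupData.gl 3 F).automorphicQuotient)
      [(AdelicGroupData.gl 3 F).IsAutomorphicMeasure μm],
      hasSatakeParamAt_iff_L2 hF3 μm)
    (hss : ∀ (F : Type) [Field F] [NumberField F] (hF3 : isCompact_glFiniteIntegralLevel 3 F),
      AutomorphicRepsGL.stable_cuspidal_eq_sSup_irreducible hF3) :
    Ramakrishnan2014_selfdualGL3_adjointLift :=
  of_selfdual_of_centralCharacter hA fun F _ _ hF3 P => by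
    obtain ⟨μm, hμm⟩ := AdelicGroupData.exists_isAutomorphicMeasure_gl_holds 3 F
    haveI := hμm
    exact exists_heckeCharacter_prod_satake_of_sSup_irreducible (hAss F hF3 μm) (hL2 F hF3 μm)
      (hss F hF3) P

end Ramakrishnan2014_selfdualGL3_adjointLift

/-! ### Step 3 of the printed proof: the simple pole of `L^S(s, Π, sym²)` at `s = 1` -/

section SymmSquarePole

/-- The Euler polynomial is multiplicative in the multiset:
`∏_{a ∈ s + t} (1 - a X) = ∏_{a ∈ s} (1 - a X) · ∏_{a ∈ t} (1 - a X)` (local copy of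
`eulerPolynomial_add` of `AsaiSign`). [folklore] -/
private theorem eulerPolynomial_add₃ (s t : Multiset ℂ) :
    eulerPolynomial (s + t) = eulerPolynomial s * eulerPolynomial t := by
  simp [eulerPolynomial]


/-- **The Euler factor identity of step 2, as polynomials**: for a selfdual rank-`3` parameter
`t` (`card t = 3`, no zero entry, `t⁻¹ = t`),
`det(1 - t ⊗ t T) = det(1 - Sym² t T) · det(1 - t ⊗ {det t} T)` — the local form of
`L^S(s, Π × Π) = L^S(s, Π, sym²) · L^S(s, Π ⊗ ω_Π)` (Ramakrishnan 2014, proof of Theorem A;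
`satakeTensor_self_eq_of_map_inv_eq_self` and the multiplicativity of Euler polynomials).
[cite: Ramakrishnan2014, proof of Theorem A] -/
theorem satakePairPolynomial_self_eq_of_map_inv_eq_self {α : Multiset ℂ}
    (h3 : Multiset.card α = 3) (h0 : (0 : ℂ) ∉ α) (h : α.map (fun a => a⁻¹) = α) :
    satakePairPolynomial α α =
      eulerPolynomial (symmSqParams α) * satakePairPolynomial α {α.prod} := by
  obtain ⟨-, h2, -⟩ := satakeTensor_self_eq_of_map_inv_eq_self h3 h0 h
  rw [satakePairPolynomial_eq_eulerPolynomial, satakePairPolynomial_eq_eulerPolynomial, h2,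
    satakeTensor_singleton_right, eulerPolynomial_add₃]

/-- If an infinite product in `ℂ` converges (unconditionally) to a non-zero value then every factor
is non-zero (a zero factor kills all large partial products). [folklore] -/
theorem ne_zero_of_hasProd_ne_zero {ι : Type*} {g : ι → ℂ} {b : ℂ} (hg : HasProd g b)
    (hb : b ≠ 0) (i : ι) : g i ≠ 0 := by
  intro h0
  apply hb
  have ht : Tendsto (fun s : Finset ι => ∏ j ∈ s, g j) atTop (𝓝 b) := hg
  have hz : ∀ᶠ s : Finset ι in atTop, (0 : ℂ) = ∏ j ∈ s, g j := by
    filter_upwards [eventually_ge_atTop ({i} : Finset ι)] with s hs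
    exact (Finset.prod_eq_zero (hs (Finset.mem_singleton_self i)) h0).symm
  exact tendsto_nhds_unique ht (tendsto_const_nhds.congr' hz)

/-- **Dividing out a convergent non-vanishing Euler product**: if `∏ (f_i g_i)` converges to `a`
and `∏ g_i` converges to `b ≠ 0` (unconditionally, in `ℂ`), then `∏ f_i` converges to `a / b`
(partial products: `∏_s f = ∏_s (f g) / ∏_s g`). [folklore] -/
theorem hasProd_div_of_hasProd_mul {ι : Type*} {f g : ι → ℂ} {a b : ℂ}
    (hfg : HasProd (fun i => f i * g i) a) (hg : HasProd g b) (hb : b ≠ 0) :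
    HasProd f (a / b) := by
  have hg0 : ∀ i, g i ≠ 0 := ne_zero_of_hasProd_ne_zero hg hb
  have htfg : Tendsto (fun s : Finset ι => ∏ j ∈ s, f j * g j) atTop (𝓝 a) := hfg
  have htg : Tendsto (fun s : Finset ι => ∏ j ∈ s, g j) atTop (𝓝 b) := hg
  have heq : (fun s : Finset ι => ∏ j ∈ s, f j) =
      fun s : Finset ι => (∏ j ∈ s, f j * g j) / ∏ j ∈ s, g j := by
    funext s
    rw [Finset.prod_mul_distrib, mul_div_cancel_right₀]
    exact Finset.prod_ne_zero_iff.mpr fun j _ => hg0 j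
  show Tendsto (fun s : Finset ι => ∏ j ∈ s, f j) atTop (𝓝 (a / b))
  rw [heq]
  exact htfg.div htg hb

/-- `x² = 1` forces `‖x‖ = 1` (`ω_Π² = 1` makes the Satake family of a selfdual `Π` unitary in the
sense of the Jacquet–Shalika facts, `|det t_{Π,w}| = 1`). [folklore] -/
theorem norm_eq_one_of_sq_eq_one {x : ℂ} (h : x ^ 2 = 1) : ‖x‖ = 1 := by
  have h' : ‖x‖ ^ 2 = 1 := by rw [← norm_pow, h, norm_one]
  exact (pow_eq_one_iff_of_nonneg (norm_nonneg x) two_ne_zero).mp h'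

variable {F : Type} [Field F] [NumberField F]

/-- **A Hecke character as a cuspidal datum on `GL(1)`** with Satake parameter `{θ(ϖ_w)}` at almost
every place: the line `ℂ · (θ ∘ det)` over `⊥` (`exists_automorphicRepData_detTwist_glOne`; on
`GL(1)` every automorphic form is a cusp form, the parabolic condition being empty), with the
Satake parameters of `AutomorphicRepData.hasSatakeParamAt_detTwist_glOne` off a level of `θ`
(`HeckeCharacter.exists_level_glOne`) — the statement of
`exists_cuspidal_glOne_hasSatakeParamAt_valueAtUniformizer` (`BockleHuiIrreducibleGL3AnalyticProofs`),
re-derived here (privately) to keep the imports of this file small. Borel–Jacquet 1979, 4.6 (automorphic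
representations of `GL(1)` = idèle class characters). [cite: BorelJacquetCorvallis1979, §4.6] -/
private theorem exists_cuspidal_glOne_of_heckeCharacter
    (h1 : isCompact_glFiniteIntegralLevel 1 F) (θ : HeckeCharacter F) :
    ∃ τ : CuspidalAutomorphicRepData 1 F h1,
      ∀ᶠ w : HeightOneSpectrum (𝓞 F) in cofinite, τ.1.HasSatakeParamAt w {θ.valueAtUniformizer w} := by
  obtain ⟨τ, hW, hW'⟩ := exists_automorphicRepData_detTwist_glOne h1 θ
  have hcusp : τ.W ≤ cuspFormsGL 1 F h1 := by
    rw [hW, Submodule.span_le]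
    rintro _ rfl
    exact IsCuspFormGL.mem_cuspFormsGL
      ⟨isAutomorphicForm_detTwist_glOne h1 θ, fun k hk hk1 => absurd hk1 (by omega)⟩
  refine ⟨⟨τ, hcusp⟩, ?_⟩
  obtain ⟨𝔪, h𝔪, hθ𝔪⟩ :=
    Literature.NumberTheory.GaloisRepresentations.HeckeCharacter.exists_level_glOne θ
  filter_upwards [(Ideal.finite_factors h𝔪).compl_mem_cofinite] with w hw
  exact AutomorphicRepData.hasSatakeParamAt_detTwist_glOne h1 hW hW' h𝔪 hθ𝔪 w hw
    (Literature.NumberTheory.GaloisRepresentations.HeckeCharacter.valued_uniformizer (K := F) w)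

/-- **Step 3 of the printed proof, analytic core: `L^S(s, Π, sym²)` has a simple pole at `s = 1`
for a selfdual cuspidal `Π` on `GL₃`** (Ramakrishnan 2014, proof of Theorem A: from
`L^S(s, Π × Π) = L^S(s, Π, sym²) L^S(s, Π ⊗ ω)`, the simple pole of `L^S(s, Π × Π^∨) = L^S(s, Π × Π)`
at `s = 1` [Jacquet–Shalika] and the holomorphy and non-vanishing of `L^S(s, Π ⊗ ω)` at `s = 1`,
"`L^S(s, Π; sym²)` has a pole at `s = 1`"). Borel–Jacquet data, granting Jacquet–Shalika
(2.1)–(2.3) for such data (`JacquetShalika1981_multipliable_partialPairL_repData`,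
`…_partialPairL_boundary_repData`, `…_partialPairL_pole_repData` of `PairLFunctionPolesRepData`):
let `A` be cuspidal on `GL₃(𝔸_F)` with Satake family `Af` off a finite `T`, selfdual
(`Af(w)⁻¹ = Af(w)`), and `τ` a cuspidal datum on `GL₁` with Satake family `{det Af(w)}` off `T`
(the central character `ω = ω_A`, quadratic: `(det Af(w))² = 1`). Then for every finite `S`
containing a finite `S₀ ⊇ T`, the symmetric square Euler product
`L^S(s, A, sym²) = ∏_{v ∉ S} det(1 - Sym² Af(v) q_v^{-s})⁻¹` (`partialStandardL S (Sym² ∘ Af)`)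
converges for `s` near `1` with `Re s > 1` and `(s - 1) L^S(s, A, sym²) → c ≠ 0` as `s → 1`,
`Re s > 1`: factor by factor `det(1 - Af ⊗ Af T) = det(1 - Sym² Af T) det(1 - Af ⊗ {ω} T)`
(`satakePairPolynomial_self_eq_of_map_inv_eq_self`), `L^S(s, A × τ) → c₂ ≠ 0` ((2.2), ranks
`3 ≠ 1` so `X = ∅`), hence `L^S(s, A × τ) ≠ 0` near `1` and there
`L^S(s, A, sym²) = L^S(s, A × A) / L^S(s, A × τ)` (`hasProd_div_of_hasProd_mul`, (2.1)), while
`(s - 1) L^S(s, A × A) → c₃ ≠ 0` ((2.3): `A` selfdual, `1 ∈ X`); so `c = c₃ / c₂`.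
[cite: Ramakrishnan2014, proof of Theorem A] [cite: ArthurClozelAMS120, Ch. 3 §2 (2.1)–(2.3)] -/
theorem symmSq_pole_core
    (hJ1 : JacquetShalika1981_multipliable_partialPairL_repData)
    (hJ2 : JacquetShalika1981_partialPairL_boundary_repData)
    (hJ3 : JacquetShalika1981_partialPairL_pole_repData)
    {h1 : isCompact_glFiniteIntegralLevel 1 F} {h3 : isCompact_glFiniteIntegralLevel 3 F}
    (τ : CuspidalAutomorphicRepData 1 F h1) (A : CuspidalAutomorphicRepData 3 F h3)
    (om Af : SatakeFamily F) {T : Set (HeightOneSpectrum (𝓞 F))} (hT : T.Finite)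
    (hτ : ∀ w ∉ T, τ.1.HasSatakeParamAt w (om w)) (hA : ∀ w ∉ T, A.1.HasSatakeParamAt w (Af w))
    (hom : ∀ w ∉ T, om w = {(Af w).prod}) (hsd : ∀ w ∉ T, (Af w).map (fun a => a⁻¹) = Af w) :
    ∃ S₀ : Set (HeightOneSpectrum (𝓞 F)), S₀.Finite ∧ T ⊆ S₀ ∧
      ∀ (S : Set (HeightOneSpectrum (𝓞 F))), S.Finite → S₀ ⊆ S →
        ∃ c : ℂ, c ≠ 0 ∧
          (∀ᶠ s in 𝓝[{s : ℂ | 1 < s.re}] 1,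
            Multipliable fun v : {v : HeightOneSpectrum (𝓞 F) // v ∉ S} =>
              ((eulerPolynomial (symmSqParams (Af v.1))).eval ((v.1.residueCard : ℂ) ^ (-s)))⁻¹) ∧
          Tendsto (fun s => (s - 1) * partialStandardL S (fun v => symmSqParams (Af v)) s)
            (𝓝[{s : ℂ | 1 < s.re}] 1) (𝓝 c) := by
  -- the exceptional sets of the four instances of (2.1)–(2.3)
  obtain ⟨S₂, hS₂, hJ1b⟩ := hJ1 3 1 F h3 h1 (by norm_num) one_pos A τ
  obtain ⟨S₃, hS₃, hJ1c⟩ := hJ1 3 3 F h3 h3 (by norm_num) (by norm_num) A A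
  obtain ⟨S₅, hS₅, hJ3b⟩ := hJ3 3 F h3 (by norm_num) A A
  obtain ⟨S₇, hS₇, hJ2a⟩ := hJ2 3 1 F h3 h1 (by norm_num) one_pos A τ
  refine ⟨T ∪ S₂ ∪ S₃ ∪ S₅ ∪ S₇, (((hT.union hS₂).union hS₃).union hS₅).union hS₇,
    fun x hx => by simp [hx], fun S hS hsub => ?_⟩
  have hTS : ∀ w ∉ S, w ∉ T := fun w hw hwT => hw (hsub (by simp [hwT]))
  have sub₂ : S₂ ⊆ S := fun x hx => hsub (by simp [hx])
  have sub₃ : S₃ ⊆ S := fun x hx => hsub (by simp [hx])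
  have sub₅ : S₅ ⊆ S := fun x hx => hsub (by simp [hx])
  have sub₇ : S₇ ⊆ S := fun x hx => hsub (by simp [hx])
  -- the hypotheses off `S`
  have hτS : ∀ w ∉ S, τ.1.HasSatakeParamAt w (om w) := fun w hw => hτ w (hTS w hw)
  have hAS : ∀ w ∉ S, A.1.HasSatakeParamAt w (Af w) := fun w hw => hA w (hTS w hw)
  have hsq : ∀ w ∉ S, (Af w).prod ^ 2 = 1 := fun w hw =>
    prod_sq_eq_one_of_map_inv_eq_self (hAS w hw).zero_not_mem (hsd w (hTS w hw))
  have huAS : ∀ w ∉ S, ‖(Af w).prod‖ = 1 := fun w hw => norm_eq_one_of_sq_eq_one (hsq w hw)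
  have huomS : ∀ w ∉ S, ‖(om w).prod‖ = 1 := fun w hw => by
    rw [hom w (hTS w hw), Multiset.prod_singleton, huAS w hw]
  -- the `X`-condition of (2.3) for `(A, A)` at `s₀ = 1`: `A` is selfdual
  have hXAA : ∀ᶠ w : HeightOneSpectrum (𝓞 F) in cofinite,
      (Af w).map ((((w.residueCard : ℂ)) ^ ((1 : ℂ) - 1)) * ·) = (Af w).map (·⁻¹) := by
    filter_upwards [hT.eventually_cofinite_notMem] with w hw
    rw [sub_self, Complex.cpow_zero, hsd w hw]
    simp
  -- (2.1) for `(A, τ)` and `(A, A)`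
  have mA1 : ∀ s : ℂ, 1 < s.re → Multipliable fun v : {v : HeightOneSpectrum (𝓞 F) // v ∉ S} =>
      ((satakePairPolynomial (Af v.1) (om v.1)).eval ((v.1.residueCard : ℂ) ^ (-s)))⁻¹ :=
    fun s hs => hJ1b hS sub₂ hAS hτS huAS huomS hs
  have mAA : ∀ s : ℂ, 1 < s.re → Multipliable fun v : {v : HeightOneSpectrum (𝓞 F) // v ∉ S} =>
      ((satakePairPolynomial (Af v.1) (Af v.1)).eval ((v.1.residueCard : ℂ) ^ (-s)))⁻¹ :=
    fun s hs => hJ1c hS sub₃ hAS hAS huAS huAS hs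
  -- (2.2) for `(A, τ)`: `L^S(s, A × τ) → c₂ ≠ 0` (`3 ≠ 1`, so `X = ∅`)
  obtain ⟨c₂, hc₂, hF⟩ := hJ2a hS sub₇ hAS hτS huAS huomS Complex.one_re
    (fun h => absurd h.1 (by norm_num))
  -- (2.3) for `(A, A)`: `(s - 1) L^S(s, A × A) → c₃ ≠ 0`
  obtain ⟨c₃, hc₃, hG⟩ := hJ3b hS sub₅ hAS hAS huAS huAS Complex.one_re hXAA
  -- near `s = 1`: `Re s > 1` and `L^S(s, A × τ) ≠ 0`
  have hre : ∀ᶠ s in 𝓝[{s : ℂ | 1 < s.re}] (1 : ℂ), 1 < s.re := eventually_mem_nhdsWithin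
  have hne : ∀ᶠ s in 𝓝[{s : ℂ | 1 < s.re}] (1 : ℂ), partialPairL S Af om s ≠ 0 :=
    hF.eventually_ne hc₂
  -- the factorisation `L^S(s, A × A) = L^S(s, A, sym²) L^S(s, A × τ)`, divided out
  have key : ∀ s : ℂ, 1 < s.re → partialPairL S Af om s ≠ 0 →
      HasProd (fun v : {v : HeightOneSpectrum (𝓞 F) // v ∉ S} =>
        ((eulerPolynomial (symmSqParams (Af v.1))).eval ((v.1.residueCard : ℂ) ^ (-s)))⁻¹)
        (partialPairL S Af Af s / partialPairL S Af om s) := by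
    intro s hs hn
    refine hasProd_div_of_hasProd_mul ?_ (mA1 s hs).hasProd hn
    have hfun : (fun v : {v : HeightOneSpectrum (𝓞 F) // v ∉ S} =>
        ((eulerPolynomial (symmSqParams (Af v.1))).eval ((v.1.residueCard : ℂ) ^ (-s)))⁻¹ *
          ((satakePairPolynomial (Af v.1) (om v.1)).eval ((v.1.residueCard : ℂ) ^ (-s)))⁻¹) =
        fun v : {v : HeightOneSpectrum (𝓞 F) // v ∉ S} =>
          ((satakePairPolynomial (Af v.1) (Af v.1)).eval ((v.1.residueCard : ℂ) ^ (-s)))⁻¹ := by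
      funext v
      rw [satakePairPolynomial_self_eq_of_map_inv_eq_self (hAS v.1 v.2).card_eq
        (hAS v.1 v.2).zero_not_mem (hsd v.1 (hTS v.1 v.2)), ← hom v.1 (hTS v.1 v.2), eval_mul,
        mul_inv]
    rw [hfun]
    exact (mAA s hs).hasProd
  refine ⟨c₃ / c₂, div_ne_zero hc₃ hc₂, ?_, ?_⟩
  · filter_upwards [hre, hne] with s hs hn
    exact ⟨_, key s hs hn⟩
  · have heq : (fun s => (s - 1) * partialPairL S Af Af s / partialPairL S Af om s) =ᶠ[𝓝[{s : ℂ | 1 < s.re}] 1]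
        fun s => (s - 1) * partialStandardL S (fun v => symmSqParams (Af v)) s := by
      filter_upwards [hre, hne] with s hs hn
      simp only [partialStandardL]
      rw [(key s hs hn).tprod_eq, mul_div_assoc]
    exact (hG.div hF hc₂).congr' heq

/-- **Step 3 for the named fact's data: the symmetric square `L`-function of a selfdual cuspidal
`Π` on `GL₃(𝔸_F)` has a simple pole at `s = 1`** (Ramakrishnan 2014, proof of Theorem A),
for a cuspidal Borel–Jacquet datum `Π` whose Satake parameters are selfdual at almost every place
(the hypothesis of Theorem A in the tree's rendering), granting Jacquet–Shalika (2.1)–(2.3) for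
Borel–Jacquet data and a Hecke character `Ω` with `Ω(ϖ_v) = ∏ t_{Π,v}` a.e. (the central
character `ω_Π`, hypothesis `hΩ`; `ω_Π² = 1`): there are a Satake family `Af` of `Π` off a finite
`S₀` such that for every finite `S ⊇ S₀`, `L^S(s, Π, sym²) = ∏_{v ∉ S} det(1 - Sym² t_{Π,v} q_v^{-s})⁻¹`
converges near `s = 1` (`Re s > 1`) and `(s - 1) L^S(s, Π, sym²) → c ≠ 0` (`s → 1`, `Re s > 1`).
The realisation of `ω_Π` as a cuspidal datum on `GL₁` with Satake parameters `{ω_Π(ϖ_w)}` is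
the local `exists_cuspidal_glOne_of_heckeCharacter`; the rest is `symmSq_pole_core`.
(The printed proof continues: by Ginzburg–Rallis–Soudry this pole makes `Π ⊗ ω_Π` the lift of a
generic cuspidal representation of `SL₂(𝔸_F)` — a statement with no carrier in the tree.)
[cite: Ramakrishnan2014, proof of Theorem A] [cite: ArthurClozelAMS120, Ch. 3 §2 (2.1)–(2.3)] -/
theorem Ramakrishnan2014_selfdualGL3_adjointLift.symmSq_pole_of_selfdual
    (hJ1 : JacquetShalika1981_multipliable_partialPairL_repData)
    (hJ2 : JacquetShalika1981_partialPairL_boundary_repData)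
    (hJ3 : JacquetShalika1981_partialPairL_pole_repData)
    {hF3 : isCompact_glFiniteIntegralLevel 3 F} (P : CuspidalAutomorphicRepData 3 F hF3)
    (hsd : ∀ᶠ v : HeightOneSpectrum (𝓞 F) in Filter.cofinite, ∀ α : Multiset ℂ,
      P.1.HasSatakeParamAt v α → α.map (fun a => a⁻¹) = α)
    (hΩ : ∃ Ω : HeckeCharacter F, ∀ᶠ v : HeightOneSpectrum (𝓞 F) in Filter.cofinite,
      ∀ α : Multiset ℂ, P.1.HasSatakeParamAt v α → Ω.valueAtUniformizer v = α.prod) :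
    ∃ (Af : SatakeFamily F) (S₀ : Set (HeightOneSpectrum (𝓞 F))), S₀.Finite ∧
      (∀ w ∉ S₀, P.1.HasSatakeParamAt w (Af w)) ∧
      ∀ (S : Set (HeightOneSpectrum (𝓞 F))), S.Finite → S₀ ⊆ S →
        ∃ c : ℂ, c ≠ 0 ∧
          (∀ᶠ s in 𝓝[{s : ℂ | 1 < s.re}] 1,
            Multipliable fun v : {v : HeightOneSpectrum (𝓞 F) // v ∉ S} =>
              ((eulerPolynomial (symmSqParams (Af v.1))).eval ((v.1.residueCard : ℂ) ^ (-s)))⁻¹) ∧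
          Tendsto (fun s => (s - 1) * partialStandardL S (fun v => symmSqParams (Af v)) s)
            (𝓝[{s : ℂ | 1 < s.re}] 1) (𝓝 c) := by
  obtain ⟨Ω, hΩP⟩ := hΩ
  have h1 : isCompact_glFiniteIntegralLevel 1 F := isCompact_glFiniteIntegralLevel_holds 1 F
  -- `ω_Π` as a cuspidal datum on `GL₁`
  obtain ⟨τ, hτ⟩ := exists_cuspidal_glOne_of_heckeCharacter h1 Ω
  -- a Satake family of `Π`
  obtain ⟨Af, eAf⟩ : ∃ f : SatakeFamily F, ∀ᶠ w : HeightOneSpectrum (𝓞 F) in cofinite,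
      P.1.HasSatakeParamAt w (f w) :=
    ⟨fun w => if h : P.1.IsUnramifiedAt w then h.choose else 0, by
      filter_upwards [P.1.hasSatakeParamAt_cofinite_holds] with w hw
      rw [dif_pos hw]
      exact hw.choose_spec⟩
  -- the good places
  have hgood : ∀ᶠ w : HeightOneSpectrum (𝓞 F) in cofinite,
      P.1.HasSatakeParamAt w (Af w) ∧ (Af w).map (fun a => a⁻¹) = Af w ∧
        Ω.valueAtUniformizer w = (Af w).prod ∧
        τ.1.HasSatakeParamAt w {Ω.valueAtUniformizer w} := by
    filter_upwards [eAf, hsd, hΩP, hτ] with w h1w h2w h3w h4w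
    exact ⟨h1w, h2w _ h1w, h3w _ h1w, h4w⟩
  obtain ⟨T, hT, hgoodT⟩ : ∃ T : Set (HeightOneSpectrum (𝓞 F)), T.Finite ∧ ∀ w ∉ T,
      P.1.HasSatakeParamAt w (Af w) ∧ (Af w).map (fun a => a⁻¹) = Af w ∧
        Ω.valueAtUniformizer w = (Af w).prod ∧
        τ.1.HasSatakeParamAt w {Ω.valueAtUniformizer w} :=
    ⟨_, Filter.eventually_cofinite.1 hgood, fun w hw => not_not.1 hw⟩
  obtain ⟨S₀, hS₀, hTS₀, hcore⟩ := symmSq_pole_core hJ1 hJ2 hJ3 τ P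
    (fun w => {Ω.valueAtUniformizer w}) Af hT (fun w hw => (hgoodT w hw).2.2.2)
    (fun w hw => (hgoodT w hw).1) (fun w hw => by rw [(hgoodT w hw).2.2.1])
    (fun w hw => (hgoodT w hw).2.1)
  exact ⟨Af, S₀, hS₀, fun w hw => (hgoodT w fun h => hw (hTS₀ h)).1, hcore⟩

/-- **Step 3 from Jacquet–Shalika and the Borel–Jacquet dictionary**: the central-character
hypothesis `hΩ` of `symmSq_pole_of_selfdual` is supplied by
`exists_heckeCharacter_prod_satake_of_sSup_irreducible` granted the dictionary leaves at rank `3`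
(`exists_isAssociatedL2`, `hasSatakeParamAt_iff_L2`, `stable_cuspidal_eq_sSup_irreducible`) and
Borel–Harish-Chandra finiteness (`exists_isAutomorphicMeasure_gl_holds`) — the same leaves to which
`PairLFunctionPolesRepData` reduces (2.1)–(2.3) for Borel–Jacquet data.
[cite: Ramakrishnan2014, proof of Theorem A] [cite: BorelJacquetCorvallis1979, §4.6 and 5.7] -/
theorem Ramakrishnan2014_selfdualGL3_adjointLift.symmSq_pole_of_selfdual_of_leaves
    (hJ1 : JacquetShalika1981_multipliable_partialPairL_repData)
    (hJ2 : JacquetShalika1981_partialPairL_boundary_repData)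
    (hJ3 : JacquetShalika1981_partialPairL_pole_repData)
    {hF3 : isCompact_glFiniteIntegralLevel 3 F}
    {μm : _root_.MeasureTheory.Measure (AdelicGroupData.gl 3 F).automorphicQuotient}
    [(AdelicGroupData.gl 3 F).IsAutomorphicMeasure μm]
    (hAss : AutomorphicRepsGL.exists_isAssociatedL2 hF3 μm) (hL2 : hasSatakeParamAt_iff_L2 hF3 μm)
    (hss : AutomorphicRepsGL.stable_cuspidal_eq_sSup_irreducible hF3)
    (P : CuspidalAutomorphicRepData 3 F hF3)
    (hsd : ∀ᶠ v : HeightOneSpectrum (𝓞 F) in Filter.cofinite, ∀ α : Multiset ℂ,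
      P.1.HasSatakeParamAt v α → α.map (fun a => a⁻¹) = α) :
    ∃ (Af : SatakeFamily F) (S₀ : Set (HeightOneSpectrum (𝓞 F))), S₀.Finite ∧
      (∀ w ∉ S₀, P.1.HasSatakeParamAt w (Af w)) ∧
      ∀ (S : Set (HeightOneSpectrum (𝓞 F))), S.Finite → S₀ ⊆ S →
        ∃ c : ℂ, c ≠ 0 ∧
          (∀ᶠ s in 𝓝[{s : ℂ | 1 < s.re}] 1,
            Multipliable fun v : {v : HeightOneSpectrum (𝓞 F) // v ∉ S} =>
              ((eulerPolynomial (symmSqParams (Af v.1))).eval ((v.1.residueCard : ℂ) ^ (-s)))⁻¹) ∧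
          Tendsto (fun s => (s - 1) * partialStandardL S (fun v => symmSqParams (Af v)) s)
            (𝓝[{s : ℂ | 1 < s.re}] 1) (𝓝 c) :=
  symmSq_pole_of_selfdual hJ1 hJ2 hJ3 P hsd
    (exists_heckeCharacter_prod_satake_of_sSup_irreducible hAss hL2 hss P)

end SymmSquarePole

/-! ### Step 5 (part): `π` is not dihedral when `Ad(π) ⊗ ν` is cuspidal -/

section NonDihedral

/-- **`Ad` of a dihedral parameter against its quadratic sign, factor by factor.** For a
`GL₂`-parameter `t = {x, y}` (no zero entry) which is a self-twist by `e` (`e t = t`; at an inert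
place of `K/F`, `e = ε_{K/F}(v) = -1` and `t = {c, -c}`) and scalars with `a b = (det t)⁻¹`:
`det(1 - a t ⊗ b t T) = det(1 - e Ad(t) T) · (1 - e T)` — i.e.
`L(s, π_v × π_v^∨) = L(s, Ad(π_v) ⊗ ε_v) L(s, ε_v)` at such a place, since
`t ⊗ t⁻¹ = Ad(t) + {1}` and `e Ad(t) + {e} = e (t ⊗ t⁻¹) = (e t) ⊗ t⁻¹ = t ⊗ t⁻¹`. [folklore] -/
theorem satakePairPolynomial_twists_eq_of_selfTwist {t : Multiset ℂ} (h2 : Multiset.card t = 2)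
    (h0 : (0 : ℂ) ∉ t) {e a b : ℂ} (he : t.map (e * ·) = t) (hab : a * b = (t.prod)⁻¹) :
    satakePairPolynomial (t.map (a * ·)) (t.map (b * ·)) =
      satakePairPolynomial (adParams t) {e} * satakePairPolynomial {e} {1} := by
  have ht0 : t ≠ 0 := by
    intro h
    rw [h, Multiset.card_zero] at h2
    exact absurd h2 (by norm_num)
  rw [satakePairPolynomial_eq_eulerPolynomial, satakePairPolynomial_eq_eulerPolynomial,
    satakePairPolynomial_eq_eulerPolynomial, satakeTensor_map_mul_map_mul, hab,
    satakeTensor_singleton_right, satakeTensor_singleton_right, Multiset.map_singleton, one_mul,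
    ← eulerPolynomial_add]
  congr 1
  symm
  calc (adParams t).map (e * ·) + {e}
      = (adParams t + {1}).map (e * ·) := by rw [Multiset.map_add, Multiset.map_singleton, mul_one]
    _ = (satakeTensor t (t.map fun b => b⁻¹)).map (e * ·) := by
          rw [adParams_add_singleton_one ht0 h0]
    _ = satakeTensor (t.map (e * ·)) (t.map fun b => b⁻¹) := by rw [satakeTensor_map_mul_left]
    _ = satakeTensor t (t.map fun b => b⁻¹) := by rw [he]
    _ = satakeTensor t (t.map ((t.prod)⁻¹ * ·)) := by rw [map_inv_eq_map_mul_of_card_eq_two h2 h0]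
    _ = (satakeTensor t t).map ((t.prod)⁻¹ * ·) := by rw [satakeTensor_map_mul_right]

variable {F : Type} [Field F] [NumberField F]

/-- **Analytic core: a dihedral `π` cannot have a cuspidal adjoint, via Jacquet–Shalika.** Granting
(2.1)–(2.3) for Borel–Jacquet data: there are no cuspidal data `τ₁, τ_ε` on `GL(1)`, `A` on `GL(3)`
and `P₁, P₂` on `GL(2)` over `F` with unitary Satake families `{1}`, `eps`, `Af`, `p₁`,
`p₂ = p₁⁻¹` off a finite `T`, `eps` not eventually `{1}`, and
`det(1 - p₁ ⊗ p₂ T) = det(1 - Af ⊗ eps T) det(1 - eps ⊗ {1} T)` — for then on `Re s > 1`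
`L^S(s, P₁ × P₂) = L^S(s, A × τ_ε) L^S(s, τ_ε × τ₁)` ((2.1)), whose right side has a finite limit
as `s → 1⁺` ((2.2) twice: ranks `3 ≠ 1`; `τ_ε ≇ τ₁` since `eps ≠ {1}` at infinitely many places),
so `(s - 1) L^S(s, P₁ × P₂) → 0`, against the simple pole of (2.3) for `(P₁, P₂ = P₁^∨)`. This is
the Rankin–Selberg form of "`Ad(π)` is not cuspidal for dihedral `π`" (`Ad(I(θ)) = ε_{K/F} ⊞ I(θ/θ^σ)`:
`L(s, Ad(π) ⊗ ε_{K/F})` inherits the pole of `ζ_F`) used in Ramakrishnan 2014, proof of Theorem A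
("`π` is non-dihedral as `Π` is cuspidal") and Gelbart–Jacquet 1978, Thm. (9.3).
[cite: Ramakrishnan2014, proof of Theorem A] [cite: ArthurClozelAMS120, Ch. 3 §2 (2.1)–(2.3)] -/
theorem adjoint_dihedral_core
    (hJ1 : JacquetShalika1981_multipliable_partialPairL_repData)
    (hJ2 : JacquetShalika1981_partialPairL_boundary_repData)
    (hJ3 : JacquetShalika1981_partialPairL_pole_repData)
    {h1 : isCompact_glFiniteIntegralLevel 1 F} {h2 : isCompact_glFiniteIntegralLevel 2 F}
    {h3 : isCompact_glFiniteIntegralLevel 3 F}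
    (τ1 τε : CuspidalAutomorphicRepData 1 F h1) (A : CuspidalAutomorphicRepData 3 F h3)
    (P₁ P₂ : CuspidalAutomorphicRepData 2 F h2) (one eps Af p₁ p₂ : SatakeFamily F)
    {T : Set (HeightOneSpectrum (𝓞 F))} (hT : T.Finite) (hone : ∀ w, one w = {1})
    (hτ1 : ∀ w ∉ T, τ1.1.HasSatakeParamAt w (one w))
    (hτε : ∀ w ∉ T, τε.1.HasSatakeParamAt w (eps w))
    (hA : ∀ w ∉ T, A.1.HasSatakeParamAt w (Af w))
    (hP₁ : ∀ w ∉ T, P₁.1.HasSatakeParamAt w (p₁ w)) (hP₂ : ∀ w ∉ T, P₂.1.HasSatakeParamAt w (p₂ w))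
    (huA : ∀ w ∉ T, ‖(Af w).prod‖ = 1) (hueps : ∀ w ∉ T, ‖(eps w).prod‖ = 1)
    (hu₁ : ∀ w ∉ T, ‖(p₁ w).prod‖ = 1) (hu₂ : ∀ w ∉ T, ‖(p₂ w).prod‖ = 1)
    (hX : ∀ w ∉ T, (p₂ w).map (·⁻¹) = p₁ w)
    (hXε : ¬ ∀ᶠ w : HeightOneSpectrum (𝓞 F) in cofinite, eps w = {1})
    (hId : ∀ w ∉ T, satakePairPolynomial (p₁ w) (p₂ w) =
      satakePairPolynomial (Af w) (eps w) * satakePairPolynomial (eps w) (one w)) :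
    False := by
  -- the exceptional sets of the five instances of (2.1)–(2.3)
  obtain ⟨S₁, hS₁, hJ1a⟩ := hJ1 3 1 F h3 h1 (by norm_num) one_pos A τε
  obtain ⟨S₂, hS₂, hJ1b⟩ := hJ1 1 1 F h1 h1 one_pos one_pos τε τ1
  obtain ⟨S₃, hS₃, hJ2a⟩ := hJ2 3 1 F h3 h1 (by norm_num) one_pos A τε
  obtain ⟨S₄, hS₄, hJ2b⟩ := hJ2 1 1 F h1 h1 one_pos one_pos τε τ1
  obtain ⟨S₅, hS₅, hJ3a⟩ := hJ3 2 F h2 (by norm_num) P₁ P₂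
  set S : Set (HeightOneSpectrum (𝓞 F)) := T ∪ S₁ ∪ S₂ ∪ S₃ ∪ S₄ ∪ S₅ with hS_def
  have hS : S.Finite := ((((hT.union hS₁).union hS₂).union hS₃).union hS₄).union hS₅
  have hTS : ∀ w ∉ S, w ∉ T := fun w hw hwT => hw (by simp [hS_def, hwT])
  have sub₁ : S₁ ⊆ S := fun x hx => by simp [hS_def, hx]
  have sub₂ : S₂ ⊆ S := fun x hx => by simp [hS_def, hx]
  have sub₃ : S₃ ⊆ S := fun x hx => by simp [hS_def, hx]
  have sub₄ : S₄ ⊆ S := fun x hx => by simp [hS_def, hx]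
  have sub₅ : S₅ ⊆ S := fun x hx => by simp [hS_def, hx]
  -- the hypotheses off `S`
  have hτ1S : ∀ w ∉ S, τ1.1.HasSatakeParamAt w (one w) := fun w hw => hτ1 w (hTS w hw)
  have hτεS : ∀ w ∉ S, τε.1.HasSatakeParamAt w (eps w) := fun w hw => hτε w (hTS w hw)
  have hAS : ∀ w ∉ S, A.1.HasSatakeParamAt w (Af w) := fun w hw => hA w (hTS w hw)
  have hP₁S : ∀ w ∉ S, P₁.1.HasSatakeParamAt w (p₁ w) := fun w hw => hP₁ w (hTS w hw)
  have hP₂S : ∀ w ∉ S, P₂.1.HasSatakeParamAt w (p₂ w) := fun w hw => hP₂ w (hTS w hw)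
  have huone : ∀ w ∉ S, ‖(one w).prod‖ = 1 := fun w _ => by rw [hone]; simp
  have huAS : ∀ w ∉ S, ‖(Af w).prod‖ = 1 := fun w hw => huA w (hTS w hw)
  have huepsS : ∀ w ∉ S, ‖(eps w).prod‖ = 1 := fun w hw => hueps w (hTS w hw)
  have hu₁S : ∀ w ∉ S, ‖(p₁ w).prod‖ = 1 := fun w hw => hu₁ w (hTS w hw)
  have hu₂S : ∀ w ∉ S, ‖(p₂ w).prod‖ = 1 := fun w hw => hu₂ w (hTS w hw)
  -- the `X`-condition of (2.2) for `(τ_ε, τ₁)` at `s₀ = 1`: `eps` is not eventually `{1}`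
  have hXε' : ¬ ((1 : ℕ) = 1 ∧ ∀ᶠ w : HeightOneSpectrum (𝓞 F) in cofinite,
      (eps w).map ((((w.residueCard : ℂ)) ^ ((1 : ℂ) - 1)) * ·) = (one w).map (·⁻¹)) := by
    rintro ⟨-, h⟩
    apply hXε
    filter_upwards [h] with w hw
    rw [sub_self, Complex.cpow_zero, hone] at hw
    simpa using hw
  -- the `X`-condition of (2.3) for `(P₁, P₂)` at `s₀ = 1`
  have hXP : ∀ᶠ w : HeightOneSpectrum (𝓞 F) in cofinite,
      (p₁ w).map ((((w.residueCard : ℂ)) ^ ((1 : ℂ) - 1)) * ·) = (p₂ w).map (·⁻¹) := by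
    filter_upwards [hT.eventually_cofinite_notMem] with w hw
    rw [sub_self, Complex.cpow_zero, hX w hw]
    simp
  -- (2.1): multipliability of the two Euler products on the right
  have mAε : ∀ s : ℂ, 1 < s.re → Multipliable fun v : {v : HeightOneSpectrum (𝓞 F) // v ∉ S} =>
      ((satakePairPolynomial (Af v.1) (eps v.1)).eval ((v.1.residueCard : ℂ) ^ (-s)))⁻¹ :=
    fun s hs => hJ1a hS sub₁ hAS hτεS huAS huepsS hs
  have mε1 : ∀ s : ℂ, 1 < s.re → Multipliable fun v : {v : HeightOneSpectrum (𝓞 F) // v ∉ S} =>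
      ((satakePairPolynomial (eps v.1) (one v.1)).eval ((v.1.residueCard : ℂ) ^ (-s)))⁻¹ :=
    fun s hs => hJ1b hS sub₂ hτεS hτ1S huepsS huone hs
  -- (2.2) for `(A, τ_ε)` (`3 ≠ 1`) and for `(τ_ε, τ₁)`: finite limits
  obtain ⟨c₁, -, hF₁⟩ := hJ2a hS sub₃ hAS hτεS huAS huepsS Complex.one_re
    (fun h => absurd h.1 (by norm_num))
  obtain ⟨c₂, -, hF₂⟩ := hJ2b hS sub₄ hτεS hτ1S huepsS huone Complex.one_re hXε'
  -- (2.3) for `(P₁, P₂)`: a simple pole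
  obtain ⟨c₃, hc₃, hG⟩ := hJ3a hS sub₅ hP₁S hP₂S hu₁S hu₂S Complex.one_re hXP
  -- the factorisation on `Re s > 1`
  have hL : ∀ᶠ s in 𝓝[{s : ℂ | 1 < s.re}] (1 : ℂ),
      partialPairL S p₁ p₂ s = partialPairL S Af eps s * partialPairL S eps one s := by
    refine eventually_nhdsWithin_of_forall fun s hs => ?_
    unfold partialPairL
    have hfun : (fun v : {v : HeightOneSpectrum (𝓞 F) // v ∉ S} =>
        ((satakePairPolynomial (p₁ v.1) (p₂ v.1)).eval ((v.1.residueCard : ℂ) ^ (-s)))⁻¹) =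
        fun v : {v : HeightOneSpectrum (𝓞 F) // v ∉ S} =>
          ((satakePairPolynomial (Af v.1) (eps v.1)).eval ((v.1.residueCard : ℂ) ^ (-s)))⁻¹ *
            ((satakePairPolynomial (eps v.1) (one v.1)).eval ((v.1.residueCard : ℂ) ^ (-s)))⁻¹ := by
      funext v
      rw [hId v.1 (hTS v.1 v.2), eval_mul, mul_inv]
    rw [hfun, (mAε s (by exact hs)).tprod_mul (mε1 s (by exact hs))]
  -- `(s - 1) L^S(s, P₁ × P₂) → 0`, against the simple pole
  have h0 : Tendsto (fun s => (s - 1) * partialPairL S p₁ p₂ s) (𝓝[{s : ℂ | 1 < s.re}] 1)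
      (𝓝 (0 * c₁ * c₂)) := by
    refine ((tendsto_sub_one_nhdsWithin_one_lt_re.mul hF₁).mul hF₂).congr' ?_
    filter_upwards [hL] with s hs
    simp only [hs, mul_assoc]
  rw [zero_mul, zero_mul] at h0
  exact hc₃ (tendsto_nhds_unique hG h0)

/-- **`π` is not dihedral when some cuspidal `Π` on `GL₃` has Satake parameters `ν(ϖ_v) Ad(t_{π,v})`
a.e.** (Ramakrishnan 2014, proof of Theorem A: "`π` is non-dihedral as `Π` is cuspidal" —
`Ad(I_K^F(θ)) ≃ ε_{K/F} ⊞ I_K^F(θ/θ^σ)` is not cuspidal; Gelbart–Jacquet 1978, Thm. (9.3): the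
adjoint lift is cuspidal "unless `π` is monomial"). Borel–Jacquet data, on Satake parameters
(`IsQuadraticSelfTwistAE`: `t_{π,v} = ε_{K/F}(v) t_{π,v}` a.e., the shadow of `π ≅ π ⊗ ε_{K/F}`),
granting Jacquet–Shalika (2.1)–(2.3) for such data and a Hecke character `Ω` with
`Ω(ϖ_v) = det t_{π,v}` a.e. (the central character of `π`, hypothesis `hω`). Proof (Rankin–Selberg
form of the printed remark): with `ε = ε_{K/F}` as a Hecke character `≠ 1`
(`exists_ne_one_heckeCharacter_quadraticSign`), `A = Π ⊗ ν⁻¹` (`t_A = Ad(t_π)`,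
`CuspidalAutomorphicRepData.exists_twist_hecke_hasSatakeParamAt`), the unitary normalisation
`P₁ = π ⊗ ν₀`, `P₂ = π ⊗ (ν₀ Ω)⁻¹ ≃ P₁^∨` (`|Ω| = ‖·‖^σ`, `ν₀ = ‖·‖^{-σ/2}`), and the factor identity
`det(1 - t_{P₁} ⊗ t_{P₂} T) = det(1 - ε Ad(t_π) T)(1 - ε T)` at the self-twist places
(`satakePairPolynomial_twists_eq_of_selfTwist`), `adjoint_dihedral_core` applies.
[cite: Ramakrishnan2014, proof of Theorem A] [cite: GelbartJacquet1978, Thm. (9.3)]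
[cite: ArthurClozelAMS120, Ch. 3 §2 (2.1)–(2.3)] -/
theorem Ramakrishnan2014_selfdualGL3_adjointLift.not_isQuadraticSelfTwistAE_of_JS
    (hJ1 : JacquetShalika1981_multipliable_partialPairL_repData)
    (hJ2 : JacquetShalika1981_partialPairL_boundary_repData)
    (hJ3 : JacquetShalika1981_partialPairL_pole_repData)
    {hF2 : isCompact_glFiniteIntegralLevel 2 F} {hF3 : isCompact_glFiniteIntegralLevel 3 F}
    (π : CuspidalAutomorphicRepData 2 F hF2)
    (hω : ∃ Ω : HeckeCharacter F, ∀ᶠ v : HeightOneSpectrum (𝓞 F) in cofinite, ∀ β : Multiset ℂ,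
      π.1.HasSatakeParamAt v β → Ω.valueAtUniformizer v = β.prod)
    (P : CuspidalAutomorphicRepData 3 F hF3) (ν : HeckeCharacter F)
    (hsat : ∀ᶠ v : HeightOneSpectrum (𝓞 F) in Filter.cofinite, ∀ β : Multiset ℂ,
      π.1.HasSatakeParamAt v β →
        P.1.HasSatakeParamAt v ((adParams β).map fun c => ν.valueAtUniformizer v * c))
    (K : Type) [Field K] [NumberField K] [Algebra F K] (hK : Module.finrank F K = 2) :
    ¬ IsQuadraticSelfTwistAE K π.1 := by
  intro hdih
  obtain ⟨Ω, hΩ⟩ := hω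
  have h1 : isCompact_glFiniteIntegralLevel 1 F := isCompact_glFiniteIntegralLevel_holds 1 F
  -- `ε = ε_{K/F}` as a Hecke character `≠ 1`
  obtain ⟨ε, hε1, -, hε⟩ := exists_ne_one_heckeCharacter_quadraticSign (F := F) (E := K) hK
  -- `A = Π ⊗ ν⁻¹`, with `t_A = Ad(t_π)`
  haveI : NeZero (3 : ℕ) := ⟨by norm_num⟩
  obtain ⟨A, hA⟩ := CuspidalAutomorphicRepData.exists_twist_hecke_hasSatakeParamAt ν⁻¹ P
  -- `1` and `ε` as cuspidal data on `GL(1)`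
  obtain ⟨τ1, hτ1⟩ := exists_cuspidal_glOne_of_heckeCharacter h1 (1 : HeckeCharacter F)
  obtain ⟨τε, hτε⟩ := exists_cuspidal_glOne_of_heckeCharacter h1 ε
  -- the unitary normalisation `P₁ = π ⊗ ν₀`, `P₂ = π ⊗ (ν₀ Ω)⁻¹`
  obtain ⟨σ, hσ⟩ := Ω.exists_norm_apply_eq_ideleNorm_rpow
  obtain ⟨ν₀, hν₀⟩ := exists_heckeCharacter_ideleNorm_cpow F ((-(σ / 2) : ℝ) : ℂ)
  have hνΩ : ∀ x : ideleGroup F, ‖((ν₀ x : ℂˣ) : ℂ)‖ ^ 2 * ‖((Ω x : ℂˣ) : ℂ)‖ = 1 := by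
    intro x
    have hN : (0 : ℝ) < GaloisRepresentations.ideleNorm x := by
      rw [← coe_ideleNorm]
      exact NNReal.coe_pos.2 (pos_iff_ne_zero.2 (ideleNorm_ne_zero _))
    rw [hν₀ x, Complex.norm_cpow_eq_rpow_re_of_pos hN, Complex.ofReal_re, hσ x,
      ← Real.rpow_natCast, ← Real.rpow_mul hN.le, ← Real.rpow_add hN]
    have e : -(σ / 2) * ((2 : ℕ) : ℝ) + σ = 0 := by push_cast; ring
    rw [e, Real.rpow_zero]
  haveI : NeZero (2 : ℕ) := ⟨by norm_num⟩
  obtain ⟨P₁, hP₁⟩ := CuspidalAutomorphicRepData.exists_twist_hecke_hasSatakeParamAt ν₀ π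
  obtain ⟨P₂, hP₂⟩ := CuspidalAutomorphicRepData.exists_twist_hecke_hasSatakeParamAt (ν₀ * Ω)⁻¹ π
  -- a Satake family of `π`
  obtain ⟨tf, etf⟩ : ∃ f : SatakeFamily F, ∀ᶠ w : HeightOneSpectrum (𝓞 F) in cofinite,
      π.1.HasSatakeParamAt w (f w) :=
    ⟨fun w => if h : π.1.IsUnramifiedAt w then h.choose else 0, by
      filter_upwards [π.1.hasSatakeParamAt_cofinite_holds] with w hw
      rw [dif_pos hw]
      exact hw.choose_spec⟩
  -- the good places
  have hgood : ∀ᶠ w : HeightOneSpectrum (𝓞 F) in cofinite,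
      π.1.HasSatakeParamAt w (tf w) ∧ (tf w).map (ε.valueAtUniformizer w * ·) = tf w ∧
      (ε.valueAtUniformizer w = 1 ∨ ε.valueAtUniformizer w = -1) ∧
      Ω.valueAtUniformizer w = (tf w).prod ∧
      A.1.HasSatakeParamAt w (adParams (tf w)) ∧ τ1.1.HasSatakeParamAt w {1} ∧
      τε.1.HasSatakeParamAt w {ε.valueAtUniformizer w} ∧
      P₁.1.HasSatakeParamAt w ((tf w).map (ν₀.valueAtUniformizer w * ·)) ∧
      P₂.1.HasSatakeParamAt w ((tf w).map ((ν₀ * Ω)⁻¹.valueAtUniformizer w * ·)) := by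
    have hdih' : ∀ᶠ w : HeightOneSpectrum (𝓞 F) in cofinite, ∀ α : Multiset ℂ,
        π.1.HasSatakeParamAt w α → α.map (quadraticSign K w * ·) = α := hdih
    filter_upwards [etf, hdih', hε, hΩ, hsat, hA, hτ1, hτε, hP₁, hP₂]
      with w h1w hdw hεw hΩw hsw hAw hτ1w hτεw hP₁w hP₂w
    refine ⟨h1w, ?_, ?_, hΩw _ h1w, ?_, ?_, hτεw, hP₁w _ h1w, hP₂w _ h1w⟩
    · rw [hεw.2]; exact hdw _ h1w
    · rw [hεw.2]; exact quadraticSign_eq_one_or (E := K) w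
    · have h := hAw _ (hsw _ h1w)
      rw [Multiset.map_map] at h
      convert h using 2
      refine (Multiset.map_congr rfl fun x _ => ?_).trans (Multiset.map_id' _) |>.symm
      simp only [Function.comp_apply]
      rw [heckeCharacter_valueAtUniformizer_inv, ← mul_assoc,
        inv_mul_cancel₀ (heckeCharacter_valueAtUniformizer_ne_zero ν w), one_mul]
    · simpa only [Ramakrishnan2014_selfdualGL3_adjointLift.one_valueAtUniformizer] using hτ1w
  obtain ⟨T, hT, hgoodT⟩ : ∃ T : Set (HeightOneSpectrum (𝓞 F)), T.Finite ∧ ∀ w ∉ T,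
      π.1.HasSatakeParamAt w (tf w) ∧ (tf w).map (ε.valueAtUniformizer w * ·) = tf w ∧
      (ε.valueAtUniformizer w = 1 ∨ ε.valueAtUniformizer w = -1) ∧
      Ω.valueAtUniformizer w = (tf w).prod ∧
      A.1.HasSatakeParamAt w (adParams (tf w)) ∧ τ1.1.HasSatakeParamAt w {1} ∧
      τε.1.HasSatakeParamAt w {ε.valueAtUniformizer w} ∧
      P₁.1.HasSatakeParamAt w ((tf w).map (ν₀.valueAtUniformizer w * ·)) ∧
      P₂.1.HasSatakeParamAt w ((tf w).map ((ν₀ * Ω)⁻¹.valueAtUniformizer w * ·)) :=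
    ⟨_, Filter.eventually_cofinite.1 hgood, fun w hw => not_not.1 hw⟩
  -- pointwise consequences at a good place
  have card2 : ∀ w ∉ T, Multiset.card (tf w) = 2 := fun w hw => (hgoodT w hw).1.card_eq
  have nz : ∀ w ∉ T, (0 : ℂ) ∉ tf w := fun w hw => (hgoodT w hw).1.zero_not_mem
  have hlam : ∀ w, (ν₀ * Ω)⁻¹.valueAtUniformizer w =
      (ν₀.valueAtUniformizer w)⁻¹ * (Ω.valueAtUniformizer w)⁻¹ := fun w => by
    rw [heckeCharacter_valueAtUniformizer_inv,
      GaloisRepresentations.HeckeCharacter.valueAtUniformizer_mul, mul_inv]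
  have hX : ∀ w ∉ T, ((tf w).map ((ν₀ * Ω)⁻¹.valueAtUniformizer w * ·)).map (·⁻¹) =
      (tf w).map (ν₀.valueAtUniformizer w * ·) := by
    intro w hw
    obtain ⟨-, -, -, hΩw, -⟩ := hgoodT w hw
    have hν0 := heckeCharacter_valueAtUniformizer_ne_zero ν₀ w
    have hp0 : (tf w).prod ≠ 0 := Multiset.prod_ne_zero (nz w hw)
    rw [Multiset.map_map]
    calc (tf w).map ((fun x => x⁻¹) ∘ ((ν₀ * Ω)⁻¹.valueAtUniformizer w * ·))
        = ((tf w).map (fun x => x⁻¹)).map ((ν₀.valueAtUniformizer w * Ω.valueAtUniformizer w) * ·) := by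
            rw [Multiset.map_map]
            refine Multiset.map_congr rfl fun x _ => ?_
            simp only [Function.comp_apply]
            rw [hlam, mul_inv, mul_inv, inv_inv, inv_inv]
      _ = (tf w).map (ν₀.valueAtUniformizer w * ·) := by
            rw [map_inv_eq_map_mul_of_card_eq_two (card2 w hw) (nz w hw), Multiset.map_map, hΩw]
            refine Multiset.map_congr rfl fun x _ => ?_
            simp only [Function.comp_apply]
            rw [← mul_assoc, mul_assoc (ν₀.valueAtUniformizer w), mul_inv_cancel₀ hp0, mul_one]
  have hu₁ : ∀ w ∉ T, ‖((tf w).map (ν₀.valueAtUniformizer w * ·)).prod‖ = 1 := by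
    intro w hw
    obtain ⟨-, -, -, hΩw, -⟩ := hgoodT w hw
    rw [prod_map_const_mul_eq, card2 w hw, ← hΩw, norm_mul, norm_pow]
    exact hνΩ (localUnits w (GaloisRepresentations.HeckeCharacter.uniformizer F w))
  have hu₂ : ∀ w ∉ T, ‖((tf w).map ((ν₀ * Ω)⁻¹.valueAtUniformizer w * ·)).prod‖ = 1 := by
    intro w hw
    have e : (tf w).map ((ν₀ * Ω)⁻¹.valueAtUniformizer w * ·) =
        ((tf w).map (ν₀.valueAtUniformizer w * ·)).map (·⁻¹) := by
      rw [← hX w hw, Multiset.map_map]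
      simp
    rw [e, Multiset.prod_map_inv, Multiset.map_id', norm_inv, hu₁ w hw, inv_one]
  have huA : ∀ w ∉ T, ‖(adParams (tf w)).prod‖ = 1 := fun w hw => by
    rw [prod_adParams_of_card_eq_two (card2 w hw) (nz w hw), norm_one]
  have hueps : ∀ w ∉ T, ‖({ε.valueAtUniformizer w} : Multiset ℂ).prod‖ = 1 := fun w hw => by
    rw [Multiset.prod_singleton]
    rcases (hgoodT w hw).2.2.1 with h | h <;> simp [h]
  have hXε : ¬ ∀ᶠ w : HeightOneSpectrum (𝓞 F) in cofinite,
      ({ε.valueAtUniformizer w} : Multiset ℂ) = {1} := by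
    intro h
    apply hε1
    exact GaloisRepresentations.HeckeCharacter.eq_one_of_eventually_valueAtUniformizer_eq_one
      (h.mono fun w hw => Multiset.singleton_inj.mp hw)
  have hId : ∀ w ∉ T,
      satakePairPolynomial ((tf w).map (ν₀.valueAtUniformizer w * ·))
          ((tf w).map ((ν₀ * Ω)⁻¹.valueAtUniformizer w * ·)) =
        satakePairPolynomial (adParams (tf w)) {ε.valueAtUniformizer w} *
          satakePairPolynomial {ε.valueAtUniformizer w} {1} := by
    intro w hw
    obtain ⟨-, hew, -, hΩw, -⟩ := hgoodT w hw
    refine satakePairPolynomial_twists_eq_of_selfTwist (card2 w hw) (nz w hw) hew ?_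
    rw [hlam, ← mul_assoc, mul_inv_cancel₀ (heckeCharacter_valueAtUniformizer_ne_zero ν₀ w), one_mul,
      hΩw]
  exact adjoint_dihedral_core hJ1 hJ2 hJ3 τ1 τε A P₁ P₂ (fun _ => {1})
    (fun w => {ε.valueAtUniformizer w}) (fun w => adParams (tf w))
    (fun w => (tf w).map (ν₀.valueAtUniformizer w * ·))
    (fun w => (tf w).map ((ν₀ * Ω)⁻¹.valueAtUniformizer w * ·))
    hT (fun _ => rfl) (fun w hw => (hgoodT w hw).2.2.2.2.2.1) (fun w hw => (hgoodT w hw).2.2.2.2.2.2.1)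
    (fun w hw => (hgoodT w hw).2.2.2.2.1) (fun w hw => (hgoodT w hw).2.2.2.2.2.2.2.1)
    (fun w hw => (hgoodT w hw).2.2.2.2.2.2.2.2) huA hueps hu₁ hu₂ hX hXε hId

/-- **The named fact from the bare descent statement, Jacquet–Shalika and the Borel–Jacquet
dictionary.** Combining `of_selfdual_of_leaves` with `not_isQuadraticSelfTwistAE_of_JS`: it
suffices to know, for every cuspidal `Π` on `GL₃(𝔸_F)` with selfdual Satake parameters a.e., a
cuspidal `π` on `GL₂(𝔸_F)` and a Hecke character `ν` with `ν² = 1` and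
`t_{Π,v} = ν(ϖ_v) Ad(t_{π,v})` a.e. (hypothesis `hA'` — steps 4–5 of the printed proof: the pole of
`L^S(s, Π, sym²)`, the descent of Ginzburg–Rallis–Soudry to `SL₂` and Labesse–Langlands; the
non-dihedrality of `π` is then automatic), granted (2.1)–(2.3) for Borel–Jacquet data and the
dictionary leaves at ranks `2` and `3` (central characters of `π` and `Π` at Satake level).
[cite: Ramakrishnan2014, Theorem A and its proof] [cite: Shavali2026, Lemma 4.7 (proof)] -/
theorem Ramakrishnan2014_selfdualGL3_adjointLift.of_selfdualLift_of_JS_of_leaves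
    (hA' : ∀ (F : Type) [Field F] [NumberField F] (hF2 : isCompact_glFiniteIntegralLevel 2 F)
      (hF3 : isCompact_glFiniteIntegralLevel 3 F) (P : CuspidalAutomorphicRepData 3 F hF3),
      (∀ᶠ v : HeightOneSpectrum (𝓞 F) in Filter.cofinite, ∀ α : Multiset ℂ,
          P.1.HasSatakeParamAt v α → α.map (fun a => a⁻¹) = α) →
      ∃ (π : CuspidalAutomorphicRepData 2 F hF2) (ν : HeckeCharacter F),
        ν ^ 2 = 1 ∧
        ∀ᶠ v : HeightOneSpectrum (𝓞 F) in Filter.cofinite, ∀ β : Multiset ℂ,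
          π.1.HasSatakeParamAt v β →
            ν.IsUnramifiedAt v ∧
              P.1.HasSatakeParamAt v ((adParams β).map fun c => ν.valueAtUniformizer v * c))
    (hJ1 : JacquetShalika1981_multipliable_partialPairL_repData)
    (hJ2 : JacquetShalika1981_partialPairL_boundary_repData)
    (hJ3 : JacquetShalika1981_partialPairL_pole_repData)
    (hAss : ∀ (n : ℕ) (F : Type) [Field F] [NumberField F] (hF : isCompact_glFiniteIntegralLevel n F)
      (μm : _root_.MeasureTheory.Measure (AdelicGroupData.gl n F).automorphicQuotient)
      [(AdelicGroupData.gl n F).IsAutomorphicMeasure μm],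
      AutomorphicRepsGL.exists_isAssociatedL2 hF μm)
    (hL2 : ∀ (n : ℕ) (F : Type) [Field F] [NumberField F] (hF : isCompact_glFiniteIntegralLevel n F)
      (μm : _root_.MeasureTheory.Measure (AdelicGroupData.gl n F).automorphicQuotient)
      [(AdelicGroupData.gl n F).IsAutomorphicMeasure μm],
      hasSatakeParamAt_iff_L2 hF μm)
    (hss : ∀ (n : ℕ) (F : Type) [Field F] [NumberField F] (hF : isCompact_glFiniteIntegralLevel n F),
      AutomorphicRepsGL.stable_cuspidal_eq_sSup_irreducible hF) :
    Ramakrishnan2014_selfdualGL3_adjointLift := by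
  refine of_selfdual_of_leaves (fun F _ _ hF2 hF3 P hsd => ?_) (hAss 3) (hL2 3) (hss 3)
  obtain ⟨π, ν, hν, hsat⟩ := hA' F hF2 hF3 P hsd
  refine ⟨π, ν, fun K _ _ _ hK => ?_, hν, hsat⟩
  obtain ⟨μm, hμm⟩ := AdelicGroupData.exists_isAutomorphicMeasure_gl_holds 2 F
  haveI := hμm
  haveI : NeZero (2 : ℕ) := ⟨two_ne_zero⟩
  exact not_isQuadraticSelfTwistAE_of_JS hJ1 hJ2 hJ3 π
    (exists_heckeCharacter_prod_satake_of_sSup_irreducible (hAss 2 F hF2 μm) (hL2 2 F hF2 μm)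
      (hss 2 F hF2) π)
    P ν (hsat.mono fun v hv β hβ => (hv β hβ).2) K hK

end NonDihedral

/-! ### Uniqueness of `π` up to twist (Theorem A) from multiplicity one for `SL(2)` -/

section Uniqueness

/-- **Rigidity of the adjoint class under scalars.** If `{u, u⁻¹, 1}` is carried to a multiset
containing `1` by multiplication by `c` (i.e. `c⁻¹ ∈ {u, u⁻¹, 1}`) with `c³ = 1`, then
`c · {u, u⁻¹, 1} = {u, u⁻¹, 1}`: either `c = 1`, or `u` is a cube root of unity with `c = u^{∓1}`
and `{u, u⁻¹, 1} = {1, ζ₃, ζ₃²}` is stable under `ζ₃`. [folklore] -/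
theorem adTriple_map_mul_eq_self {u c : ℂ} (hu : u ≠ 0)
    (hmem : c⁻¹ ∈ ({u, u⁻¹, 1} : Multiset ℂ)) (hc3 : c ^ 3 = 1) :
    ({u, u⁻¹, 1} : Multiset ℂ).map (c * ·) = {u, u⁻¹, 1} := by
  simp only [Multiset.insert_eq_cons, Multiset.mem_cons, Multiset.mem_singleton] at hmem
  simp only [Multiset.insert_eq_cons, Multiset.map_cons, Multiset.map_singleton, mul_one]
  rcases hmem with h | h | h
  · -- `c = u⁻¹`, `u³ = 1`
    have hcu : c = u⁻¹ := by rw [← h, inv_inv]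
    have hu3 : u ^ 3 = 1 := by
      have := hc3; rw [hcu, inv_pow] at this; exact inv_eq_one.mp this
    have e1 : c * u = 1 := by rw [hcu, inv_mul_cancel₀ hu]
    have e2 : c * u⁻¹ = u := by
      rw [hcu, ← mul_left_inj' hu, mul_assoc, inv_mul_cancel₀ hu, mul_one, ← mul_left_inj' hu,
        inv_mul_cancel₀ hu]
      calc (1 : ℂ) = u ^ 3 := hu3.symm
        _ = u * u * u := by ring
    rw [e1, e2, hcu, triple_rotate 1 u u⁻¹]
  · -- `c = u`, `u³ = 1`
    have hcu : c = u := by rw [← inv_inv c, h, inv_inv]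
    have hu3 : u ^ 3 = 1 := by rw [← hcu]; exact hc3
    have e1 : c * u = u⁻¹ := by
      rw [hcu, ← mul_left_inj' hu, inv_mul_cancel₀ hu]
      calc u * u * u = u ^ 3 := by ring
        _ = 1 := hu3
    have e2 : c * u⁻¹ = 1 := by rw [hcu, mul_inv_cancel₀ hu]
    rw [e1, e2, hcu, triple_rotate u⁻¹ 1 u, triple_rotate 1 u u⁻¹]
  · -- `c = 1`
    have hc1 : c = 1 := by rw [← inv_inv c, h, inv_one]
    simp [hc1]

/-- **The adjoint class determines itself under unramified twists.** For `GL₂`-parameters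
`β, β'` (two entries, no zero) and a scalar `c` with `Ad(β') = c · Ad(β)` (two twisted adjoint
parameters `ν Ad(t_π) = ν' Ad(t_{π'})` of the same `Π`, `c = ν/ν'`), in fact `Ad(β') = Ad(β)`:
`1 ∈ Ad(β')` gives `c⁻¹ ∈ Ad(β)`, determinants give `c³ = 1`, and `adTriple_map_mul_eq_self`
applies. [folklore] -/
theorem adParams_eq_of_eq_map_mul {β β' : Multiset ℂ} (h2 : Multiset.card β = 2)
    (h0 : (0 : ℂ) ∉ β) (h2' : Multiset.card β' = 2) (h0' : (0 : ℂ) ∉ β') {c : ℂ}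
    (h : adParams β' = (adParams β).map (c * ·)) : adParams β' = adParams β := by
  obtain ⟨x, y, rfl⟩ := Multiset.card_eq_two.mp h2
  obtain ⟨x', y', rfl⟩ := Multiset.card_eq_two.mp h2'
  have hx : x ≠ 0 := fun e => h0 (by simp [e])
  have hy : y ≠ 0 := fun e => h0 (by simp [e])
  have hx' : x' ≠ 0 := fun e => h0' (by simp [e])
  have hy' : y' ≠ 0 := fun e => h0' (by simp [e])
  have hu : x * y⁻¹ ≠ 0 := mul_ne_zero hx (inv_ne_zero hy)
  have hA : adParams {x, y} = {x * y⁻¹, (x * y⁻¹)⁻¹, 1} := by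
    rw [adParams_pair hx hy, mul_inv, inv_inv, mul_comm x⁻¹ y]
  -- `1 ∈ Ad(β') = c Ad(β)`: `c⁻¹ ∈ Ad(β)`
  have h1 : (1 : ℂ) ∈ (adParams {x, y}).map (c * ·) := by
    rw [← h, adParams_pair hx' hy']
    simp
  obtain ⟨a, ha, hca⟩ := Multiset.mem_map.mp h1
  have hmem : c⁻¹ ∈ ({x * y⁻¹, (x * y⁻¹)⁻¹, 1} : Multiset ℂ) := by
    rw [← hA, inv_eq_of_mul_eq_one_right hca]
    exact ha
  -- determinants: `c³ = 1`
  have hc3 : c ^ 3 = 1 := by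
    rw [← prod_adParams_twist_pair c hx hy, ← h, prod_adParams_pair hx' hy']
  rw [h, hA, adTriple_map_mul_eq_self hu hmem hc3]

variable {F : Type} [Field F] [NumberField F] {hF2 : isCompact_glFiniteIntegralLevel 2 F}
  {hF3 : isCompact_glFiniteIntegralLevel 3 F}

/-- **Theorem A, uniqueness clause: "the form `π` is unique up to a character twist"**, granted
multiplicity one for `SL(2)` (Ramakrishnan 2000, Thm. 4.1.2, the named fact
`Ramakrishnan2000_multiplicityOneSL2`; the printed proof: "uniqueness of `π` up to twist is
multiplicity one for `SL(2)`"). Borel–Jacquet data, on Satake parameters: if cuspidal `π`, `π'`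
on `GL₂(𝔸_F)` and Hecke characters `ν`, `ν'` both satisfy the conclusion of
`Ramakrishnan2014_selfdualGL3_adjointLift` for the same automorphic `Π` on `GL₃(𝔸_F)`
(`t_{Π,v} = ν(ϖ_v) Ad(t_{π,v}) = ν'(ϖ_v) Ad(t_{π',v})` a.e.), then `π'` is an a.e. twist of `π`
by a Hecke character (`IsSatakeTwistBy`): at a common good place `Ad(t_{π'}) = (ν/ν')(ϖ_v) Ad(t_π)`
(uniqueness of Satake parameters of `Π`), hence `Ad(t_{π'}) = Ad(t_π)` (`adParams_eq_of_eq_map_mul`),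
hence `t_{π'} = c_v t_π` (`exists_pair_eq_map_mul_of_adjoint_eq`), and Thm. 4.1.2 applies.
[cite: Ramakrishnan2014, Theorem A] [cite: Ramakrishnan2000, Theorem 4.1.2] -/
theorem Ramakrishnan2014_selfdualGL3_adjointLift.unique_up_to_twist
    (hM : Ramakrishnan2000_multiplicityOneSL2)
    {P : AutomorphicRepData (AutomorphyDatum.gl 3 F hF3)}
    {π π' : CuspidalAutomorphicRepData 2 F hF2} {ν ν' : HeckeCharacter F}
    (h : ∀ᶠ v : HeightOneSpectrum (𝓞 F) in Filter.cofinite, ∀ β : Multiset ℂ,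
      π.1.HasSatakeParamAt v β →
        P.HasSatakeParamAt v ((adParams β).map fun c => ν.valueAtUniformizer v * c))
    (h' : ∀ᶠ v : HeightOneSpectrum (𝓞 F) in Filter.cofinite, ∀ β : Multiset ℂ,
      π'.1.HasSatakeParamAt v β →
        P.HasSatakeParamAt v ((adParams β).map fun c => ν'.valueAtUniformizer v * c)) :
    ∃ χ : HeckeCharacter F, IsSatakeTwistBy π.1 π'.1 χ := by
  refine hM F hF2 π π' ?_
  filter_upwards [h, h', π.1.hasSatakeParamAt_cofinite_holds, π'.1.hasSatakeParamAt_cofinite_holds]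
    with v hv hv' hu hu'
  obtain ⟨β, hβ⟩ := hu
  obtain ⟨β', hβ'⟩ := hu'
  have heq : (adParams β').map (fun c => ν'.valueAtUniformizer v * c) =
      (adParams β).map (fun c => ν.valueAtUniformizer v * c) :=
    P.hasSatakeParamAt_unique_holds (hv' β' hβ') (hv β hβ)
  have hν'0 := heckeCharacter_valueAtUniformizer_ne_zero ν' v
  have hAd : adParams β' =
      (adParams β).map ((ν'.valueAtUniformizer v)⁻¹ * ν.valueAtUniformizer v * ·) := by
    have e : adParams β' = ((adParams β').map (fun c => ν'.valueAtUniformizer v * c)).map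
        ((ν'.valueAtUniformizer v)⁻¹ * ·) := by
      rw [Multiset.map_map]
      refine ((Multiset.map_congr rfl fun x _ => ?_).trans (Multiset.map_id' _)).symm
      simp only [Function.comp_apply]
      rw [← mul_assoc, inv_mul_cancel₀ hν'0, one_mul]
    rw [e, heq, Multiset.map_map]
    refine Multiset.map_congr rfl fun x _ => ?_
    simp only [Function.comp_apply, mul_assoc]
  have h2 := hβ.card_eq
  have h2' := hβ'.card_eq
  have h0 := hβ.zero_not_mem
  have h0' := hβ'.zero_not_mem
  have hAd' : adParams β' = adParams β := adParams_eq_of_eq_map_mul h2 h0 h2' h0' hAd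
  obtain ⟨a, b, rfl⟩ := Multiset.card_eq_two.mp h2
  obtain ⟨a', b', rfl⟩ := Multiset.card_eq_two.mp h2'
  have ha : a ≠ 0 := fun e => h0 (by simp [e])
  have hb : b ≠ 0 := fun e => h0 (by simp [e])
  have ha' : a' ≠ 0 := fun e => h0' (by simp [e])
  have hb' : b' ≠ 0 := fun e => h0' (by simp [e])
  have hLL : ({a / b, 1, b / a} : Multiset ℂ) = {a' / b', 1, b' / a'} := by
    have e1 : ({a / b, 1, b / a} : Multiset ℂ) = adParams {a, b} := by
      rw [adParams_pair ha hb, div_eq_mul_inv, div_eq_mul_inv]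
      simp only [Multiset.insert_eq_cons]
      rw [← Multiset.cons_zero (b * a⁻¹), Multiset.cons_swap 1 (b * a⁻¹) 0, Multiset.cons_zero]
    have e2 : ({a' / b', 1, b' / a'} : Multiset ℂ) = adParams {a', b'} := by
      rw [adParams_pair ha' hb', div_eq_mul_inv, div_eq_mul_inv]
      simp only [Multiset.insert_eq_cons]
      rw [← Multiset.cons_zero (b' * a'⁻¹), Multiset.cons_swap 1 (b' * a'⁻¹) 0, Multiset.cons_zero]
    rw [e1, e2, hAd']
  obtain ⟨c, hc, hab⟩ := exists_pair_eq_map_mul_of_adjoint_eq ha hb ha' hb' hLL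
  exact ⟨{a, b}, c, hc, hβ, by rw [← hab]; exact hβ'⟩

end Uniqueness

/-! ### Update: the Borel–Jacquet dictionary and (2.1) are theorems — the fact from the descent
statement and Jacquet–Shalika (2.2), (2.3) alone -/

section Holds

variable {F : Type} [Field F] [NumberField F]

/-- `1(ϖ_v) = 1` for the trivial Hecke character (private copy of
`HeckeCharacter.valueAtUniformizer_one` of `ArtinLFunctionsAbelianProofs`, not imported here).
[folklore] -/
private theorem valueAtUniformizer_one_sd (v : HeightOneSpectrum (𝓞 F)) :
    (1 : HeckeCharacter F).valueAtUniformizer v = 1 := by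
  rw [GaloisRepresentations.HeckeCharacter.valueAtUniformizer,
    GaloisRepresentations.HeckeCharacter.localComponent_apply,
    GaloisRepresentations.HeckeCharacter.one_apply, Units.val_one]

/-- **The named fact from Theorem A as printed (selfdual `Π`, `η = 1`) — unconditionally.** The
central-character hypothesis `hΩ` of `of_selfdual_of_centralCharacter` (a Hecke character `Ω` with
`Ω(ϖ_v) = ∏ t_{Π,v}` a.e., for every cuspidal Borel–Jacquet datum `Π` on `GL₃(𝔸_F)`) is meanwhile a
theorem of the tree: `exists_heckeCharacter_prod_satake'` (`CuspidalDescentDetCubicRepData`; the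
central character of the unitary normalisation of a clean model of `Π`, Borel–Jacquet 1979, 4.6 and
5.7, from the discharged leaves `AutomorphicRepsGL.exists_le_formsOfL2_of_W'_eq_bot_holds` and
`AutomorphicRepsGL.stable_cuspidal_eq_sSup_irreducible_holds`). So the reduction of the essentially
selfdual case to the selfdual case (Ramakrishnan 2014, remark after Theorem A, p. 777; Shavali 2026,
Lemma 4.7) holds outright: **`Ramakrishnan2014_selfdualGL3_adjointLift` follows from Theorem A for
selfdual `Π` (hypothesis `hA`) and nothing else.**
[cite: Ramakrishnan2014, Theorem A and the remark following it, p. 777]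
[cite: Shavali2026, Lemma 4.7 (proof)] [cite: BorelJacquetCorvallis1979, §4.6 and 5.7] -/
theorem Ramakrishnan2014_selfdualGL3_adjointLift.of_selfdual
    (hA : ∀ (F : Type) [Field F] [NumberField F] (hF2 : isCompact_glFiniteIntegralLevel 2 F)
      (hF3 : isCompact_glFiniteIntegralLevel 3 F) (P : CuspidalAutomorphicRepData 3 F hF3),
      (∀ᶠ v : HeightOneSpectrum (𝓞 F) in Filter.cofinite, ∀ α : Multiset ℂ,
          P.1.HasSatakeParamAt v α → α.map (fun a => a⁻¹) = α) →
      ∃ (π : CuspidalAutomorphicRepData 2 F hF2) (ν : HeckeCharacter F),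
        (∀ (K : Type) [Field K] [NumberField K] [Algebra F K], Module.finrank F K = 2 →
            ¬ IsQuadraticSelfTwistAE K π.1) ∧
        ν ^ 2 = 1 ∧
        ∀ᶠ v : HeightOneSpectrum (𝓞 F) in Filter.cofinite, ∀ β : Multiset ℂ,
          π.1.HasSatakeParamAt v β →
            ν.IsUnramifiedAt v ∧
              P.1.HasSatakeParamAt v ((adParams β).map fun c => ν.valueAtUniformizer v * c)) :
    Ramakrishnan2014_selfdualGL3_adjointLift :=
  of_selfdual_of_centralCharacter hA fun _ _ _ _ P =>
    haveI : NeZero (3 : ℕ) := ⟨three_ne_zero⟩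
    exists_heckeCharacter_prod_satake' P

/-- **Step 3 — the simple pole of `L^S(s, Π, sym²)` at `s = 1` for selfdual cuspidal `Π` on
`GL₃(𝔸_F)` — from Jacquet–Shalika (2.2), (2.3) alone.** `symmSq_pole_of_selfdual` with its two
dischargeable inputs discharged: (2.1) for Borel–Jacquet data is the theorem
`JacquetShalika1981_multipliable_partialPairL_repData_holds` (`PairLFunctionPolesRepDataHolds`;
Jacquet–Shalika I, Thm. (5.3)), and the central character `ω_Π` at Satake level is
`exists_heckeCharacter_prod_satake'`. What is granted: (2.2) and (2.3) for Borel–Jacquet data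
(`JacquetShalika1981_partialPairL_boundary_repData`, `…_pole_repData`; reduced to their `L²` forms —
Jacquet–Shalika II, Prop. 3.6, Thm. 4.4; Shahidi — in `PairLFunctionPolesRepDataHolds`).
[cite: Ramakrishnan2014, proof of Theorem A] [cite: ArthurClozelAMS120, Ch. 3 §2 (2.1)–(2.3)]
[cite: JacquetShalikaAJM1981, Thm. (5.3)] -/
theorem Ramakrishnan2014_selfdualGL3_adjointLift.symmSq_pole
    (hJ2 : JacquetShalika1981_partialPairL_boundary_repData)
    (hJ3 : JacquetShalika1981_partialPairL_pole_repData)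
    {hF3 : isCompact_glFiniteIntegralLevel 3 F} (P : CuspidalAutomorphicRepData 3 F hF3)
    (hsd : ∀ᶠ v : HeightOneSpectrum (𝓞 F) in Filter.cofinite, ∀ α : Multiset ℂ,
      P.1.HasSatakeParamAt v α → α.map (fun a => a⁻¹) = α) :
    ∃ (Af : SatakeFamily F) (S₀ : Set (HeightOneSpectrum (𝓞 F))), S₀.Finite ∧
      (∀ w ∉ S₀, P.1.HasSatakeParamAt w (Af w)) ∧
      ∀ (S : Set (HeightOneSpectrum (𝓞 F))), S.Finite → S₀ ⊆ S →
        ∃ c : ℂ, c ≠ 0 ∧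
          (∀ᶠ s in 𝓝[{s : ℂ | 1 < s.re}] 1,
            Multipliable fun v : {v : HeightOneSpectrum (𝓞 F) // v ∉ S} =>
              ((eulerPolynomial (symmSqParams (Af v.1))).eval ((v.1.residueCard : ℂ) ^ (-s)))⁻¹) ∧
          Tendsto (fun s => (s - 1) * partialStandardL S (fun v => symmSqParams (Af v)) s)
            (𝓝[{s : ℂ | 1 < s.re}] 1) (𝓝 c) :=
  haveI : NeZero (3 : ℕ) := ⟨three_ne_zero⟩
  symmSq_pole_of_selfdual JacquetShalika1981_multipliable_partialPairL_repData_holds hJ2 hJ3 P hsd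
    (exists_heckeCharacter_prod_satake' P)

/-- **`π` is not dihedral when some cuspidal `Π` on `GL₃` has Satake parameters `ν(ϖ_v) Ad(t_{π,v})`
a.e. — from Jacquet–Shalika (2.2), (2.3) alone** (Ramakrishnan 2014, proof of Theorem A: "`π` is
non-dihedral as `Π` is cuspidal"; Gelbart–Jacquet 1978, Thm. (9.3)). `not_isQuadraticSelfTwistAE_of_JS`
with (2.1) discharged (`JacquetShalika1981_multipliable_partialPairL_repData_holds`) and the central
character of `π` at Satake level supplied by `exists_heckeCharacter_prod_satake'` (rank `2`).
[cite: Ramakrishnan2014, proof of Theorem A] [cite: GelbartJacquet1978, Thm. (9.3)]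
[cite: ArthurClozelAMS120, Ch. 3 §2 (2.1)–(2.3)] -/
theorem Ramakrishnan2014_selfdualGL3_adjointLift.not_isQuadraticSelfTwistAE
    (hJ2 : JacquetShalika1981_partialPairL_boundary_repData)
    (hJ3 : JacquetShalika1981_partialPairL_pole_repData)
    {hF2 : isCompact_glFiniteIntegralLevel 2 F} {hF3 : isCompact_glFiniteIntegralLevel 3 F}
    (π : CuspidalAutomorphicRepData 2 F hF2) (P : CuspidalAutomorphicRepData 3 F hF3)
    (ν : HeckeCharacter F)
    (hsat : ∀ᶠ v : HeightOneSpectrum (𝓞 F) in Filter.cofinite, ∀ β : Multiset ℂ,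
      π.1.HasSatakeParamAt v β →
        P.1.HasSatakeParamAt v ((adParams β).map fun c => ν.valueAtUniformizer v * c))
    (K : Type) [Field K] [NumberField K] [Algebra F K] (hK : Module.finrank F K = 2) :
    ¬ IsQuadraticSelfTwistAE K π.1 :=
  haveI : NeZero (2 : ℕ) := ⟨two_ne_zero⟩
  not_isQuadraticSelfTwistAE_of_JS JacquetShalika1981_multipliable_partialPairL_repData_holds hJ2 hJ3
    π (exists_heckeCharacter_prod_satake' π) P ν hsat K hK

/-- **The named fact from the bare descent statement and Jacquet–Shalika (2.2), (2.3).** It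
suffices to know, for every cuspidal `Π` on `GL₃(𝔸_F)` with selfdual Satake parameters a.e., a
cuspidal `π` on `GL₂(𝔸_F)` and a Hecke character `ν` with `ν² = 1` and `t_{Π,v} = ν(ϖ_v) Ad(t_{π,v})`
a.e. (hypothesis `hA'` — steps 4–5 of the printed proof: from the pole of `L^S(s, Π, sym²)`
(`symmSq_pole`), the descent of Ginzburg–Rallis–Soudry to `SL₂(𝔸_F)` and Labesse–Langlands
`SL₂ → GL₂`), granted (2.2), (2.3) for Borel–Jacquet data: the non-dihedrality of `π` is
`not_isQuadraticSelfTwistAE`, the passage to essentially selfdual `Π` is `of_selfdual`. Compared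
with `of_selfdualLift_of_JS_of_leaves`, (2.1) and the three dictionary leaves
(`exists_isAssociatedL2`, `hasSatakeParamAt_iff_L2`, `stable_cuspidal_eq_sSup_irreducible`) are no
longer hypotheses. [cite: Ramakrishnan2014, Theorem A and its proof]
[cite: Shavali2026, Lemma 4.7 (proof)] [cite: ArthurClozelAMS120, Ch. 3 §2 (2.2), (2.3)] -/
theorem Ramakrishnan2014_selfdualGL3_adjointLift.of_selfdualLift_of_JS
    (hA' : ∀ (F : Type) [Field F] [NumberField F] (hF2 : isCompact_glFiniteIntegralLevel 2 F)
      (hF3 : isCompact_glFiniteIntegralLevel 3 F) (P : CuspidalAutomorphicRepData 3 F hF3),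
      (∀ᶠ v : HeightOneSpectrum (𝓞 F) in Filter.cofinite, ∀ α : Multiset ℂ,
          P.1.HasSatakeParamAt v α → α.map (fun a => a⁻¹) = α) →
      ∃ (π : CuspidalAutomorphicRepData 2 F hF2) (ν : HeckeCharacter F),
        ν ^ 2 = 1 ∧
        ∀ᶠ v : HeightOneSpectrum (𝓞 F) in Filter.cofinite, ∀ β : Multiset ℂ,
          π.1.HasSatakeParamAt v β →
            ν.IsUnramifiedAt v ∧
              P.1.HasSatakeParamAt v ((adParams β).map fun c => ν.valueAtUniformizer v * c))
    (hJ2 : JacquetShalika1981_partialPairL_boundary_repData)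
    (hJ3 : JacquetShalika1981_partialPairL_pole_repData) :
    Ramakrishnan2014_selfdualGL3_adjointLift := by
  refine of_selfdual fun F _ _ hF2 hF3 P hsd => ?_
  obtain ⟨π, ν, hν, hsat⟩ := hA' F hF2 hF3 P hsd
  exact ⟨π, ν, fun K _ _ _ hK =>
    not_isQuadraticSelfTwistAE hJ2 hJ3 π P ν (hsat.mono fun v hv β hβ => (hv β hβ).2) K hK, hν, hsat⟩

/-- **Conversely, the named fact contains the bare descent statement**: Theorem A applied with
`η = 1` to a cuspidal `Π` on `GL₃(𝔸_F)` with selfdual Satake parameters a.e. yields a cuspidal `π` on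
`GL₂(𝔸_F)` and `ν` with `ν² = 1` and `t_{Π,v} = ν(ϖ_v) Ad(t_{π,v})` a.e. (the non-dihedrality clause
dropped). With `of_selfdualLift_of_JS`: granting Jacquet–Shalika (2.2), (2.3) for Borel–Jacquet data,
`Ramakrishnan2014_selfdualGL3_adjointLift` is *equivalent* to this descent statement
(`iff_selfdualLift_of_JS`) — which is why the latter is not vendored as a separate named fact.
[cite: Ramakrishnan2014, Theorem A] -/
theorem Ramakrishnan2014_selfdualGL3_adjointLift.selfdualLift
    (h : Ramakrishnan2014_selfdualGL3_adjointLift)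
    (F : Type) [Field F] [NumberField F] (hF2 : isCompact_glFiniteIntegralLevel 2 F)
    (hF3 : isCompact_glFiniteIntegralLevel 3 F) (P : CuspidalAutomorphicRepData 3 F hF3)
    (hsd : ∀ᶠ v : HeightOneSpectrum (𝓞 F) in Filter.cofinite, ∀ α : Multiset ℂ,
      P.1.HasSatakeParamAt v α → α.map (fun a => a⁻¹) = α) :
    ∃ (π : CuspidalAutomorphicRepData 2 F hF2) (ν : HeckeCharacter F),
      ν ^ 2 = 1 ∧
      ∀ᶠ v : HeightOneSpectrum (𝓞 F) in Filter.cofinite, ∀ β : Multiset ℂ,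
        π.1.HasSatakeParamAt v β →
          ν.IsUnramifiedAt v ∧
            P.1.HasSatakeParamAt v ((adParams β).map fun c => ν.valueAtUniformizer v * c) := by
  have hsd1 : ∀ᶠ v : HeightOneSpectrum (𝓞 F) in Filter.cofinite, ∀ α : Multiset ℂ,
      P.1.HasSatakeParamAt v α →
        (1 : HeckeCharacter F).IsUnramifiedAt v ∧
          α.map (fun a => a⁻¹) = α.map (fun a => (1 : HeckeCharacter F).valueAtUniformizer v * a) := by
    filter_upwards [hsd] with v hv α hα
    refine ⟨fun _ => rfl, ?_⟩
    rw [hv α hα]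
    conv_lhs => rw [← Multiset.map_id' α]
    exact Multiset.map_congr rfl fun a _ => by rw [valueAtUniformizer_one_sd, one_mul]
  obtain ⟨π, ν, -, hν, hsat⟩ := h F hF2 hF3 P 1 hsd1
  exact ⟨π, ν, by rwa [mul_one] at hν, hsat⟩

/-- **Granting Jacquet–Shalika (2.2), (2.3) for Borel–Jacquet data, the named fact is equivalent to
the bare descent statement** "every cuspidal `Π` on `GL₃(𝔸_F)` with selfdual Satake parameters a.e.
is `Ad(π) ⊗ ν` a.e. for a cuspidal `π` on `GL₂(𝔸_F)` and `ν² = 1`" (`selfdualLift`,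
`of_selfdualLift_of_JS`). [cite: Ramakrishnan2014, Theorem A and its proof] -/
theorem Ramakrishnan2014_selfdualGL3_adjointLift.iff_selfdualLift_of_JS
    (hJ2 : JacquetShalika1981_partialPairL_boundary_repData)
    (hJ3 : JacquetShalika1981_partialPairL_pole_repData) :
    Ramakrishnan2014_selfdualGL3_adjointLift ↔
      ∀ (F : Type) [Field F] [NumberField F] (hF2 : isCompact_glFiniteIntegralLevel 2 F)
        (hF3 : isCompact_glFiniteIntegralLevel 3 F) (P : CuspidalAutomorphicRepData 3 F hF3),
        (∀ᶠ v : HeightOneSpectrum (𝓞 F) in Filter.cofinite, ∀ α : Multiset ℂ,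
            P.1.HasSatakeParamAt v α → α.map (fun a => a⁻¹) = α) →
        ∃ (π : CuspidalAutomorphicRepData 2 F hF2) (ν : HeckeCharacter F),
          ν ^ 2 = 1 ∧
          ∀ᶠ v : HeightOneSpectrum (𝓞 F) in Filter.cofinite, ∀ β : Multiset ℂ,
            π.1.HasSatakeParamAt v β →
              ν.IsUnramifiedAt v ∧
                P.1.HasSatakeParamAt v ((adParams β).map fun c => ν.valueAtUniformizer v * c) :=
  ⟨fun h F _ _ hF2 hF3 P hsd => h.selfdualLift F hF2 hF3 P hsd,
    fun h => of_selfdualLift_of_JS h hJ2 hJ3⟩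

end Holds

end Literature.NumberTheory.Automorphic

end
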